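import Summits.QuantumAdvantage.QuantumAdvantage.Theses.LinnikCubicClassGroups
import Literature.NumberTheory.LFunctions.UniformClassGroupPNTGeneralDegree
import Literature.NumberTheory.LFunctions.UniformClassGroupPNTGeneralDegreeInputs
import Literature.NumberTheory.LFunctions.LogIntegralProofs
import Literature.NumberTheory.LFunctions.LogIntegralStrictMonoProofs
import Literature.NumberTheory.LFunctions.UniformClassGroupPNTTransfer
import Literature.NumberTheory.LFunctions.PrimeIdealTheorem
import Literature.NumberTheory.LFunctions.PrimeIdealCountDegreeOne
import Literature.NumberTheory.LFunctions.StarkExceptionalZero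
import Summits.QuantumAdvantage.QuantumAdvantage.Theorems.DegreeOnePrimesEscape.Negative.EscapeCounting
import Summits.QuantumAdvantage.QuantumAdvantage.Theorems.DegreeOnePrimesEscape.Negative.EscapeSign
import Summits.QuantumAdvantage.QuantumAdvantage.Theorems.DegreeOnePrimesEscape.Negative.WithoutProperFalse
import Literature.NumberTheory.LFunctions.ClassGroupLogFreeTheorem14
import Literature.NumberTheory.LFunctions.DedekindZeta1LogFreeTheorem14

/-!
# Line `subgroup-orthogonality-escape` — skeleton for crux `DegreeOnePrimesEscape`
# (stmt-QuantumAdvantage-11543, route LinnikCubicClassGroups)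

Crux (FIXED, the route's decl):
`LinnikCubicClassGroups.DegreeOnePrimesEscape :
 ∀ n, ∃ C, ∀ K ([K:ℚ] = n, no quadratic subfield), ∀ x ≥ |d_K|^C, ∀ M < Cl(𝓞 K) proper,
   π(x) ≤ 8 · #{P prime, N P prime ≤ x, [P] ∉ M}`.

## The line (idea card `Ideas/subgroup-orthogonality-escape.md`, sharpened by TRIAGE r1-1/2/3)

LEVER (subgroup orthogonality): for a subgroup `M ≤ Cl = Cl(𝓞 K)` of index `m` and the
characters `M^⊥ = {χ : χ|_M = 1}` (`|M^⊥| = m`),  `1_{Cl ∖ M} = (1 − 1/m) − (1/m) ∑_{χ ∈ M^⊥, χ ≠ 1} χ`.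
Integrated against the degree-one prime counts `a_C = #{N𝔭 prime ≤ x, [𝔭] = C}` this gives the
EXACT identity
  `#escape(M) = (1 − 1/m) · π¹_K(x) − (1/m) · ∑_{χ ∈ M^⊥, χ ≠ 1} Re ∑_C χ(C) a_C`,
so the crux needs exactly TWO one-sided analytic inputs and nothing else:
* a ONE-SIDED UPPER bound, one nontrivial character at a time: `8 · Re ∑_C χ(C) a_C ≤ Li(x)`
  (`stub_perCharacterDeficit`; SIGN-IMMUNE: a real zero `β_χ` of `L(s, χ)` enters `Re S_χ` with the
  coefficient `−Li(x^{β_χ}) ≤ 0`, so NO exceptional-zero dichotomy and NO Deuring–Heilbronn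
  repulsion is needed — classical zero-free region + log-free zero density for ONE `L(s,χ)`);
* a LOWER bound for the total count `π_K(x) ≥ (29/32) Li(x)` at `x ≥ Q^{C₁}` — the trivial
  character — which can fail only through a real zero of `ζ_K` itself very close to `1`
  (`stub_lowerPITUnlessNearbyZero`, no hypothesis on `K`), and that zero is barred for fields
  without quadratic subfield by Stark–Heilbronn (`stub_starkNoQuadSubfield`, inexplicit constant;
  the docking statement of card `heilbronn-count-discharge`, implied by the in-tree named fact
  `Stark1974_dedekindZeta_ne_zero_of_noQuadraticSubfield`, see `starkNoQuadSubfield_of_named`).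
NO UPPER BOUND for prime ideals is used anywhere (contrast: `one-sided-shadows` F_up needs the
upper prime ideal theorem at polynomial height). This is the card's "only the lower-bound half of
Thorner–Zaman" transported to depth 1, i.e. to the discharge of the Thorner–Zaman fact itself.

## Skeleton v4 (second line lead, 2026-08-16): where the line REALLY needs new mathematics

Tree audit: the field-uniform zero-free regions for `L(s,χ)` and `ζ_K` (all degrees), Landau–Page,
the smoothed explicit formulae, the Thorner–Zaman weight and the `θ → π` transfer are PROVED under
`Literature/NumberTheory/LFunctions`; the LOG-FREE ZERO-DENSITY estimate is proved only for degree
`≤ 4` (`logFreeDensity_classGroup`) resp. `≤ 2` (`logFreeDensity_dedekindZeta₁`) and carries a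
residue hypothesis `P⁻¹ ≤ κ_K`. So v3's two analytic stubs are cut one level deeper:
X1/X2 = the density estimates in every degree (the debt; printed: Weiss 1983 Thm 4.3, TZ 2017/2019
Thm 3.2), R = a polynomial residue lower bound for fields without quadratic subfield (from the Stark
stub + Hecke's integral representation), T4/T5 = the one-sided Linnik assemblies
`X1 → PerCharacterDeficitκ`, `X2 → LowerPITκ`, S = Stark (unchanged). The composition
`DegreeOnePrimesEscape_of` over the six stubs is PROVED (§4, via `escape_of_inputs`, the v3 body for a
fixed field); the v3 statements and their derivation from the TZ fact are kept (§5), and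
`cruxFromV3_holds` / `cruxFromTZStark_holds` still give TZ → Stark → crux through this file.
The appendix co-registers the six stubs of the first lead's line `dedekind-s3-collision` verbatim, so
that ONE registered skeleton serves both leads of this crux (the item holds a single stub registry).

## Contents
* §1 the three stubs (registered `stub_*`, the only `sorry`s of the file);
* §2 the lever: `index_mul_sum_filter_mem_le` (finite abelian groups; Mathlib `AddChar` duality on
  `Cl ⧸ M`: `AddChar.sum_apply_eq_ite`, `AddChar.card_eq`) — PROVED;
* §3 counting helpers (fibres of `ClassGroup.mk0`, degree ≥ 2 primes, Chebyshev) — PROVED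
  (three of them copied, with attribution, from the crux workfile `IdeatorSketchR1I3.lean`
  §`OneSidedShadows`, so that this skeleton is self-contained and does not import a sorried file);
* §4 `DegreeOnePrimesEscape_of (hD : __byName.stub_perCharacterDeficit)
  (hL : __byName.stub_lowerPITUnlessNearbyZero) (hS : __byName.stub_starkNoQuadSubfield) :
  DegreeOnePrimesEscape` — PROVED (kernel-checked composition; constants `8 · (25/64) = 25/8 > 2 log 4`);
  the `example` after it is the wiring check with the registered stubs;
* §5 the stubs FOLLOW from the vendored facts: `perCharacterDeficit_of_TZ`, `lowerPITUnlessNearbyZero_of_TZ`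
  (from `ThornerZaman2019_classPNT_hilbertClassField`), `starkNoQuadSubfield_of_named` (§1, from
  `Stark1974_dedekindZeta_ne_zero_of_noQuadraticSubfield`) — PROVED; hence `cruxFromTZStark_holds :
  TZ → Stark → DegreeOnePrimesEscape` through this skeleton (a second kernel-checked conditional proof of
  the crux, independent of `OneSidedShadows.degreeOnePrimesEscape_of_TZ_Stark`).

Disproof.lean (v4.1) honoured: `M ≠ ⊤` is used (§4, `hidx : 2 ≤ [Cl:M]`;
`degreeOnePrimesEscape_false_without_proper`, Negative/WithoutProperFalse.lean); degenerate
`n ≤ 2` handled inside (§2 of Disproof); the field hypothesis is used exactly once, at the Stark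
step (§§7, 9 `not_stark_iff`: the only enemy is a real zero of `ζ_K` itself); the sign lemma of
§10 / Negative/EscapeSign.lean is the `m = 2`, single-character shadow of §2 here.
-/

set_option linter.dupNamespace false
set_option maxHeartbeats 800000

noncomputable section

open scoped NumberField nonZeroDivisors
open Literature.NumberTheory.LFunctions Literature.NumberTheory.LFunctions.NumberField
open Summit.QuantumAdvantage.QuantumAdvantage.Theorems.DegreeOnePrimesEscape.Negative
  (escapeSet degOneInClass degOneInClass_finite degOneInClass_disjoint ncard_escapeSet_eq_sum)

namespace Summit.QuantumAdvantage.QuantumAdvantage.Cruxes.DegreeOnePrimesEscape.SubgroupOrthogonalityEscape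

/-! ## §1 The stubs (skeleton v4, second lead 2026-08-16: the two analytic stubs of v3 are cut one
level deeper, at the log-free zero-density estimate in general degree — the one analytic input of the
Thorner–Zaman side that the tree does not yet prove for degree `> 4` / `> 2` — plus a residue lower
bound; the Stark stub is unchanged and is discharged by the first lead's Literature file) -/

/-- Degree-one primes of `K` of norm `≤ x` in the class `C` (verbatim the `degOneClassCount` of
`one-sided-shadows`, so that the two lines share `PerCharacterDeficit`). [folklore] -/
def degOneClassCount (K : Type) [Field K] [NumberField K] (C : ClassGroup (𝓞 K)) (x : ℝ) : ℕ :=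
  Set.ncard {P : Ideal (𝓞 K) | (Ideal.absNorm P).Prime ∧ (Ideal.absNorm P : ℝ) ≤ x ∧
    ∃ hP : P ∈ (Ideal (𝓞 K))⁰, ClassGroup.mk0 ⟨P, hP⟩ = C}

/-! ### (A) The analytic debt: log-free zero density in GENERAL degree (tree shape) -/

open scoped Classical in
/-- **X1 · log-free zero-density estimate for the class group `L`-functions `L₀(s,χ)`, `χ ≠ 1`, of a
number field of ANY degree `n`** (constants depending on `n` only), in EXACTLY the shape of the
tree's `logFreeDensity_classGroup` (proved there for `n ≤ 4`; `logFreeDensityCG_of_le_four` below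
checks the shapes agree): size parameter `P ≥ 2` dominating `|d_K|`, `h_K`, `κ_K⁻¹` and the
heights; finite sets `Z(χ)` of zeros with `1/4 ≤ β < 1`, `|γ| ≤ P`; all `0 ≤ α ≤ 1`:
`Σ_{χ ≠ 1} Σ_{ρ ∈ Z(χ), β ≥ α} m(ρ) ≤ C_D P^{c_D(1−α)}`. In print: Weiss 1983 Thm 4.3 / Thorner–Zaman
2017 Thm 3.2 / Thorner–Zaman 2019 Thm 3.2 (for `H = Cl_K`, `𝒬 = 1`), all degrees, without the
residue hypothesis. [cite: ThornerZaman2019, Thm. 3.2] -/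
def LogFreeDensityCG : Prop :=
  ∀ n : ℕ, ∃ c_D C_D : ℝ, 0 < c_D ∧ 0 < C_D ∧
      ∀ (K : Type) [Field K] [NumberField K], Module.finrank ℚ K = n →
        (∀ χ : ClassGroup (𝓞 K) →* ℂˣ, χ ≠ 1 → ∀ ρ : ℂ, classGroupLFunction₀ K χ ρ = 0 → ρ.re < 1) →
        ∀ P : ℝ, 2 ≤ P → ((NumberField.discr K).natAbs : ℝ) ≤ P →
          (Fintype.card (ClassGroup (𝓞 K)) : ℝ) ≤ P → P⁻¹ ≤ NumberField.dedekindZeta_residue K →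
        ∀ Z : (ClassGroup (𝓞 K) →* ℂˣ) → Finset ℂ,
          (∀ χ : ClassGroup (𝓞 K) →* ℂˣ, χ ≠ 1 → ∀ ρ ∈ Z χ,
              classGroupLFunction₀ K χ ρ = 0 ∧ 1 / 4 ≤ ρ.re ∧ ρ.re < 1 ∧ |ρ.im| ≤ P) →
          ∀ α : ℝ, 0 ≤ α → α ≤ 1 →
            ∑ ψ : AddChar (Additive (ClassGroup (𝓞 K))) ℂ with ψ ≠ 0,
              ∑ ρ ∈ Z (AbelianDensity.toMulHom ψ).toHomUnits with α ≤ ρ.re,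
                (LogFreeLocal.zeroOrder (classGroupLFunction₀ K (AbelianDensity.toMulHom ψ).toHomUnits) ρ : ℝ)
                  ≤ C_D * P ^ (c_D * (1 - α))

open scoped Classical in
/-- **X2 · log-free zero-density estimate for `ζ_K` (the trivial character), ANY degree**, in
EXACTLY the shape of the tree's `logFreeDensity_dedekindZeta₁` (proved there for `n ≤ 2`;
`logFreeDensityZ1_of_le_two` checks the shapes agree). In print: Weiss 1983 Thm 4.3 (`χ = 1`),
Thorner–Zaman 2017 Thm 3.2. [cite: ThornerZaman2019, Thm. 3.2] -/
def LogFreeDensityZ1 : Prop :=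
  ∀ n : ℕ, ∃ c_D C_D : ℝ, 0 < c_D ∧ 0 < C_D ∧
      ∀ (K : Type) [Field K] [NumberField K], Module.finrank ℚ K = n →
        ∀ P : ℝ, 2 ≤ P → ((NumberField.discr K).natAbs : ℝ) ≤ P →
          (Fintype.card (ClassGroup (𝓞 K)) : ℝ) ≤ P → P⁻¹ ≤ NumberField.dedekindZeta_residue K →
        ∀ Z : Finset ℂ, (∀ ρ ∈ Z, dedekindZeta₁ K ρ = 0 ∧ 1 / 4 ≤ ρ.re ∧ ρ.re < 1 ∧ |ρ.im| ≤ P) →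
          ∀ α : ℝ, 0 ≤ α → α ≤ 1 →
            ∑ ρ ∈ Z with α ≤ ρ.re, (LogFreeLocal.zeroOrder (dedekindZeta₁ K) ρ : ℝ) ≤ C_D * P ^ (c_D * (1 - α))

/-! ### (B) The residue lower bound that feeds the size parameter `P` of (A) -/

/-- **R · polynomial lower bound for the residue `κ_K` of `ζ_K`, for fields WITHOUT quadratic
subfield** (the crux's hypothesis): for every `n` there is `A = A(n) ≥ 0` with `κ_K ≥ Q^{−A}`,
`Q = |d_K| n^n`, for every `K` of degree `n` without quadratic subfield. On paper: Stark's
zero-free interval (stub `StarkNoQuadSubfieldInexplicit`) makes `ζ_K(σ₀) < 0` at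
`σ₀ = 1 − c/log|d_K|`, and Hecke's integral representation of the completed zeta function (theta
integrand `> 0`, unit-ideal term bounded below by `e^{−O(n)}`) forces
`κ_K ≥ e^{−O(n)} (1 − σ₀) |d_K|^{−1/2}` (Stark 1974 §2 / Lang ANT XVI §2 "Brauer–Siegel à la
Stark"); alternatively Mathlib's class number formula `κ_K = 2^{r₁}(2π)^{r₂} h R/(w√|d_K|)` with
`h ≥ 1`, `w ≤ 4n²` and a uniform regulator lower bound `R ≥ c(n)`. [cite: Stark1974, Thm. 1'] -/
def ResidueLowerBound : Prop :=
  ∀ n : ℕ, ∃ A : ℝ, 0 ≤ A ∧ ∀ (K : Type) [Field K] [NumberField K], Module.finrank ℚ K = n →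
    (∀ F : IntermediateField ℚ K, Module.finrank ℚ F ≠ 2) →
    ThornerZaman.condQn K ^ (-A) ≤ NumberField.dedekindZeta_residue K

/-! ### (C) The two one-sided Linnik-type statements of the line, with the residue hypothesis -/

/-- **D_χ^κ — per-character one-sided deficit, with residue hypothesis.** For `n > 1` and `A ≥ 0`
there is `C₂ = C₂(n, A)` such that for every `K` of degree `n` with `κ_K ≥ Q^{−A}`, every
NONTRIVIAL class-group character `χ` and every `x ≥ Q^{C₂}`:
`8 · Re ∑_{N𝔭 prime ≤ x} χ([𝔭]) ≤ Li(x)`. ONE `L`-function, UPPER bound only: every REAL zero `β`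
of `L(s,χ)` enters the smoothed explicit formula as `−m(β)F(−β) ≤ 0` and is dropped; non-real
zeros obey the field-uniform zero-free region (`exists_zeroFree_classGroupLFunction₀`, in tree, all
degrees) and are summed with X1. Weaker than v3's `PerCharacterDeficit` (extra hypothesis), hence
still implied by the Thorner–Zaman fact (`perCharacterDeficitκ_of_TZ`). -/
def PerCharacterDeficitκ : Prop :=
  ∀ n : ℕ, 1 < n → ∀ A : ℝ, 0 ≤ A → ∃ C₂ : ℝ, ∀ (K : Type) [Field K] [NumberField K],
    Module.finrank ℚ K = n →
    ThornerZaman.condQn K ^ (-A) ≤ NumberField.dedekindZeta_residue K →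
    ∀ χ : ClassGroup (𝓞 K) →* ℂˣ, χ ≠ 1 →
    ∀ x : ℝ, ThornerZaman.condQn K ^ C₂ ≤ x →
      8 * ∑ C : ClassGroup (𝓞 K), ((χ C : ℂ)).re * (degOneClassCount K C x : ℝ) ≤ offsetLogIntegral x

/-- **Lower PIT unless nearby zero, with residue hypothesis.** For `n > 1`, `A ≥ 0` there is
`C₁ = C₁(n, A)` such that for every `K` of degree `n` with `κ_K ≥ Q^{−A}` and every `x ≥ Q^{C₁}`:
EITHER `29·Li(x) ≤ 32·π_K(x)`, OR `ζ_K` has a real zero `β₁ ∈ (1 − 1/(8 log Q), 1)` with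
`(1 − β₁)·log x < 4`. From X2 + the field-uniform zero-free region of `ζ_K`
(`exists_zeroFree_dedekindZeta₁`) + at most one real zero near `1` (`exists_min_realZeros_dedekindZeta₁_le`)
+ the smoothed explicit formula for `ζ_K` (`coefFordK_one_eq_explicit`), lower bound only, NO
Deuring–Heilbronn. Weaker than v3's `LowerPITUnlessNearbyZero`. -/
def LowerPITκ : Prop :=
  ∀ n : ℕ, 1 < n → ∀ A : ℝ, 0 ≤ A → ∃ C₁ : ℝ, ∀ (K : Type) [Field K] [NumberField K],
    Module.finrank ℚ K = n →
    ThornerZaman.condQn K ^ (-A) ≤ NumberField.dedekindZeta_residue K →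
    ∀ x : ℝ, ThornerZaman.condQn K ^ C₁ ≤ x →
      29 * offsetLogIntegral x ≤ 32 * (primeIdealCount K x : ℝ) ∨
      ∃ β₁ : ℝ, 1 - 1 / (8 * Real.log (ThornerZaman.condQn K)) < β₁ ∧ β₁ < 1 ∧
        dedekindZetaCont K β₁ = 0 ∧ (1 - β₁) * Real.log x < 4

/-! ### The v3 statements (kept: they are the `A`-free forms, implied by the TZ fact, §5) -/

/-- **D_χ — per-character one-sided deficit (no hypothesis on `K`)** (v3 stub 1; now a named
statement only, implied by TZ, implying `PerCharacterDeficitκ`). -/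
def PerCharacterDeficit : Prop :=
  ∀ n : ℕ, 1 < n → ∃ C₂ : ℝ, ∀ (K : Type) [Field K] [NumberField K], Module.finrank ℚ K = n →
    ∀ χ : ClassGroup (𝓞 K) →* ℂˣ, χ ≠ 1 →
    ∀ x : ℝ, ThornerZaman.condQn K ^ C₂ ≤ x →
      8 * ∑ C : ClassGroup (𝓞 K), ((χ C : ℂ)).re * (degOneClassCount K C x : ℝ) ≤ offsetLogIntegral x

/-- **Lower PIT unless nearby zero (no hypothesis on `K`)** (v3 stub 2; named statement only). -/
def LowerPITUnlessNearbyZero : Prop :=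
  ∀ n : ℕ, 1 < n → ∃ C₁ : ℝ, ∀ (K : Type) [Field K] [NumberField K], Module.finrank ℚ K = n →
    ∀ x : ℝ, ThornerZaman.condQn K ^ C₁ ≤ x →
      29 * offsetLogIntegral x ≤ 32 * (primeIdealCount K x : ℝ) ∨
      ∃ β₁ : ℝ, 1 - 1 / (8 * Real.log (ThornerZaman.condQn K)) < β₁ ∧ β₁ < 1 ∧
        dedekindZetaCont K β₁ = 0 ∧ (1 - β₁) * Real.log x < 4

/-- **Stark's no-quadratic-subfield non-vanishing with an INEXPLICIT constant** (verbatim the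
docking Prop `HeilbronnCount.StarkNoQuadSubfieldInexplicit`; shared with the first lead's line
`dedekind-s3-collision`, whose `StarkAt n` for all `n` is this statement): for every `n` there is
`c = c(n) > 0` such that for every number field `K` of degree `n` without quadratic subfield,
`ζ_K(σ) ≠ 0` for `1 − c/log|d_K| ≤ σ < 1`. Implied by the in-tree named fact
`Stark1974_dedekindZeta_ne_zero_of_noQuadraticSubfield` with `c = 1/(4·n!)`
(`starkNoQuadSubfield_of_named`), whose `_holds` the first lead is assembling
(`StarkNoQuadraticSubfieldGlue.lean` landed; fact claim held by prover-line-…-11543-0). -/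
def StarkNoQuadSubfieldInexplicit : Prop :=
  ∀ n : ℕ, ∃ c : ℝ, 0 < c ∧ ∀ (K : Type) [Field K] [NumberField K], Module.finrank ℚ K = n →
    (∀ F : IntermediateField ℚ K, Module.finrank ℚ F ≠ 2) →
    ∀ σ : ℝ, 1 - c / Real.log ((NumberField.discr K).natAbs : ℝ) ≤ σ → σ < 1 →
      dedekindZetaCont K σ ≠ 0

/-! ### The registered stubs (verbatim restatements with qualified names; the ONLY `sorry`s of this
file apart from the co-registered stubs of the first lead's line in the appendix) -/

open scoped Classical in
/-- **STUB X1 · `stub_logFreeDensityCG`** (XL; the analytic DEBT of the whole Thorner–Zaman side: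
`LogFreeDensityCG`, the tree's `logFreeDensity_classGroup` for every degree). -/
theorem stub_logFreeDensityCG : ∀ n : ℕ, ∃ c_D C_D : ℝ, 0 < c_D ∧ 0 < C_D ∧
      ∀ (K : Type) [Field K] [NumberField K], Module.finrank ℚ K = n →
        (∀ χ : ClassGroup (𝓞 K) →* ℂˣ, χ ≠ 1 → ∀ ρ : ℂ,
          Literature.NumberTheory.LFunctions.NumberField.classGroupLFunction₀ K χ ρ = 0 → ρ.re < 1) →
        ∀ P : ℝ, 2 ≤ P → ((NumberField.discr K).natAbs : ℝ) ≤ P →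
          (Fintype.card (ClassGroup (𝓞 K)) : ℝ) ≤ P → P⁻¹ ≤ NumberField.dedekindZeta_residue K →
        ∀ Z : (ClassGroup (𝓞 K) →* ℂˣ) → Finset ℂ,
          (∀ χ : ClassGroup (𝓞 K) →* ℂˣ, χ ≠ 1 → ∀ ρ ∈ Z χ,
              Literature.NumberTheory.LFunctions.NumberField.classGroupLFunction₀ K χ ρ = 0 ∧
                1 / 4 ≤ ρ.re ∧ ρ.re < 1 ∧ |ρ.im| ≤ P) →
          ∀ α : ℝ, 0 ≤ α → α ≤ 1 →
            ∑ ψ : AddChar (Additive (ClassGroup (𝓞 K))) ℂ with ψ ≠ 0,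
              ∑ ρ ∈ Z (Literature.NumberTheory.LFunctions.AbelianDensity.toMulHom ψ).toHomUnits with α ≤ ρ.re,
                (Literature.NumberTheory.LFunctions.LogFreeLocal.zeroOrder
                  (Literature.NumberTheory.LFunctions.NumberField.classGroupLFunction₀ K
                    (Literature.NumberTheory.LFunctions.AbelianDensity.toMulHom ψ).toHomUnits) ρ : ℝ)
                  ≤ C_D * P ^ (c_D * (1 - α)) := by
  sorry

open scoped Classical in
/-- **STUB X2 · `stub_logFreeDensityZ1`** (XL; `LogFreeDensityZ1`, the tree's
`logFreeDensity_dedekindZeta₁` for every degree). -/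
theorem stub_logFreeDensityZ1 : ∀ n : ℕ, ∃ c_D C_D : ℝ, 0 < c_D ∧ 0 < C_D ∧
      ∀ (K : Type) [Field K] [NumberField K], Module.finrank ℚ K = n →
        ∀ P : ℝ, 2 ≤ P → ((NumberField.discr K).natAbs : ℝ) ≤ P →
          (Fintype.card (ClassGroup (𝓞 K)) : ℝ) ≤ P → P⁻¹ ≤ NumberField.dedekindZeta_residue K →
        ∀ Z : Finset ℂ, (∀ ρ ∈ Z, Literature.NumberTheory.LFunctions.dedekindZeta₁ K ρ = 0 ∧
            1 / 4 ≤ ρ.re ∧ ρ.re < 1 ∧ |ρ.im| ≤ P) →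
          ∀ α : ℝ, 0 ≤ α → α ≤ 1 →
            ∑ ρ ∈ Z with α ≤ ρ.re,
              (Literature.NumberTheory.LFunctions.LogFreeLocal.zeroOrder
                (Literature.NumberTheory.LFunctions.dedekindZeta₁ K) ρ : ℝ) ≤ C_D * P ^ (c_D * (1 - α)) := by
  sorry

/-- **STUB R · `stub_residueFromStark`** (L): Stark's zero-free interval ⇒ the residue bound,
`StarkNoQuadSubfieldInexplicit → ResidueLowerBound`. -/
theorem stub_residueFromStark :
    (∀ n : ℕ, ∃ c : ℝ, 0 < c ∧ ∀ (K : Type) [Field K] [NumberField K], Module.finrank ℚ K = n →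
      (∀ F : IntermediateField ℚ K, Module.finrank ℚ F ≠ 2) →
      ∀ σ : ℝ, 1 - c / Real.log ((NumberField.discr K).natAbs : ℝ) ≤ σ → σ < 1 →
        Literature.NumberTheory.LFunctions.dedekindZetaCont K σ ≠ 0) →
    ∀ n : ℕ, ∃ A : ℝ, 0 ≤ A ∧ ∀ (K : Type) [Field K] [NumberField K], Module.finrank ℚ K = n →
      (∀ F : IntermediateField ℚ K, Module.finrank ℚ F ≠ 2) →
      Literature.NumberTheory.LFunctions.NumberField.ThornerZaman.condQn K ^ (-A) ≤
        NumberField.dedekindZeta_residue K := by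
  sorry

open scoped Classical in
/-- **STUB T4 · `stub_perCharacterDeficit_of_density`** (XL, the line's load-bearing one-sided
Linnik assembly): `LogFreeDensityCG → PerCharacterDeficitκ`. -/
theorem stub_perCharacterDeficit_of_density :
    (∀ n : ℕ, ∃ c_D C_D : ℝ, 0 < c_D ∧ 0 < C_D ∧
      ∀ (K : Type) [Field K] [NumberField K], Module.finrank ℚ K = n →
        (∀ χ : ClassGroup (𝓞 K) →* ℂˣ, χ ≠ 1 → ∀ ρ : ℂ,
          Literature.NumberTheory.LFunctions.NumberField.classGroupLFunction₀ K χ ρ = 0 → ρ.re < 1) →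
        ∀ P : ℝ, 2 ≤ P → ((NumberField.discr K).natAbs : ℝ) ≤ P →
          (Fintype.card (ClassGroup (𝓞 K)) : ℝ) ≤ P → P⁻¹ ≤ NumberField.dedekindZeta_residue K →
        ∀ Z : (ClassGroup (𝓞 K) →* ℂˣ) → Finset ℂ,
          (∀ χ : ClassGroup (𝓞 K) →* ℂˣ, χ ≠ 1 → ∀ ρ ∈ Z χ,
              Literature.NumberTheory.LFunctions.NumberField.classGroupLFunction₀ K χ ρ = 0 ∧
                1 / 4 ≤ ρ.re ∧ ρ.re < 1 ∧ |ρ.im| ≤ P) →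
          ∀ α : ℝ, 0 ≤ α → α ≤ 1 →
            ∑ ψ : AddChar (Additive (ClassGroup (𝓞 K))) ℂ with ψ ≠ 0,
              ∑ ρ ∈ Z (Literature.NumberTheory.LFunctions.AbelianDensity.toMulHom ψ).toHomUnits with α ≤ ρ.re,
                (Literature.NumberTheory.LFunctions.LogFreeLocal.zeroOrder
                  (Literature.NumberTheory.LFunctions.NumberField.classGroupLFunction₀ K
                    (Literature.NumberTheory.LFunctions.AbelianDensity.toMulHom ψ).toHomUnits) ρ : ℝ)
                  ≤ C_D * P ^ (c_D * (1 - α))) →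
    ∀ n : ℕ, 1 < n → ∀ A : ℝ, 0 ≤ A → ∃ C₂ : ℝ, ∀ (K : Type) [Field K] [NumberField K],
      Module.finrank ℚ K = n →
      Literature.NumberTheory.LFunctions.NumberField.ThornerZaman.condQn K ^ (-A) ≤
        NumberField.dedekindZeta_residue K →
      ∀ χ : ClassGroup (𝓞 K) →* ℂˣ, χ ≠ 1 → ∀ x : ℝ,
      Literature.NumberTheory.LFunctions.NumberField.ThornerZaman.condQn K ^ C₂ ≤ x →
        8 * ∑ C : ClassGroup (𝓞 K), ((χ C : ℂ)).re * (degOneClassCount K C x : ℝ) ≤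
          Literature.NumberTheory.LFunctions.offsetLogIntegral x := by
  sorry

open scoped Classical in
/-- **STUB T5 · `stub_lowerPIT_of_density`** (XL): `LogFreeDensityZ1 → LowerPITκ`. -/
theorem stub_lowerPIT_of_density :
    (∀ n : ℕ, ∃ c_D C_D : ℝ, 0 < c_D ∧ 0 < C_D ∧
      ∀ (K : Type) [Field K] [NumberField K], Module.finrank ℚ K = n →
        ∀ P : ℝ, 2 ≤ P → ((NumberField.discr K).natAbs : ℝ) ≤ P →
          (Fintype.card (ClassGroup (𝓞 K)) : ℝ) ≤ P → P⁻¹ ≤ NumberField.dedekindZeta_residue K →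
        ∀ Z : Finset ℂ, (∀ ρ ∈ Z, Literature.NumberTheory.LFunctions.dedekindZeta₁ K ρ = 0 ∧
            1 / 4 ≤ ρ.re ∧ ρ.re < 1 ∧ |ρ.im| ≤ P) →
          ∀ α : ℝ, 0 ≤ α → α ≤ 1 →
            ∑ ρ ∈ Z with α ≤ ρ.re,
              (Literature.NumberTheory.LFunctions.LogFreeLocal.zeroOrder
                (Literature.NumberTheory.LFunctions.dedekindZeta₁ K) ρ : ℝ) ≤ C_D * P ^ (c_D * (1 - α))) →
    ∀ n : ℕ, 1 < n → ∀ A : ℝ, 0 ≤ A → ∃ C₁ : ℝ, ∀ (K : Type) [Field K] [NumberField K],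
      Module.finrank ℚ K = n →
      Literature.NumberTheory.LFunctions.NumberField.ThornerZaman.condQn K ^ (-A) ≤
        NumberField.dedekindZeta_residue K →
      ∀ x : ℝ, Literature.NumberTheory.LFunctions.NumberField.ThornerZaman.condQn K ^ C₁ ≤ x →
        29 * Literature.NumberTheory.LFunctions.offsetLogIntegral x ≤
            32 * (Literature.NumberTheory.LFunctions.NumberField.primeIdealCount K x : ℝ) ∨
        ∃ β₁ : ℝ, 1 - 1 / (8 * Real.log (Literature.NumberTheory.LFunctions.NumberField.ThornerZaman.condQn K)) < β₁ ∧
          β₁ < 1 ∧ Literature.NumberTheory.LFunctions.dedekindZetaCont K β₁ = 0 ∧ (1 - β₁) * Real.log x < 4 := by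
  sorry

/-- **STUB S · `stub_starkNoQuadSubfield`** (L, shared docking statement with `heilbronn-count-discharge` /
`dedekind-s3-collision` / `reserve-primes-absorption`; discharged by the first lead's Literature file the
moment `Stark1974_dedekindZeta_ne_zero_of_noQuadraticSubfield_holds` lands, via
`starkNoQuadSubfield_of_named`): `StarkNoQuadSubfieldInexplicit`. -/
theorem stub_starkNoQuadSubfield : ∀ n : ℕ, ∃ c : ℝ, 0 < c ∧ ∀ (K : Type) [Field K] [NumberField K],
    Module.finrank ℚ K = n → (∀ F : IntermediateField ℚ K, Module.finrank ℚ F ≠ 2) →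
    ∀ σ : ℝ, 1 - c / Real.log ((NumberField.discr K).natAbs : ℝ) ≤ σ → σ < 1 →
      Literature.NumberTheory.LFunctions.dedekindZetaCont K σ ≠ 0 := by
  sorry

/-! ### Consistency: each named statement IS its registered stub (definitionally) -/

theorem logFreeDensityCG_holds : LogFreeDensityCG := stub_logFreeDensityCG
theorem logFreeDensityZ1_holds : LogFreeDensityZ1 := stub_logFreeDensityZ1
theorem residueLowerBound_of_stark : StarkNoQuadSubfieldInexplicit → ResidueLowerBound :=
  stub_residueFromStark
theorem perCharacterDeficitκ_of_density : LogFreeDensityCG → PerCharacterDeficitκ :=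
  stub_perCharacterDeficit_of_density
theorem lowerPITκ_of_density : LogFreeDensityZ1 → LowerPITκ := stub_lowerPIT_of_density
theorem starkNoQuadSubfieldInexplicit_holds : StarkNoQuadSubfieldInexplicit := stub_starkNoQuadSubfield

/-! ### Shape checks against the tree (the debts X1/X2 ARE the tree's theorems with the degree
restriction removed: the restricted cases are literally the tree's theorems) -/

open scoped Classical in
/-- X1 in degree `≤ 4` is the tree's `logFreeDensity_classGroup`, verbatim. -/
theorem logFreeDensityCG_of_le_four (n : ℕ) (hn : n ≤ 4) : ∃ c_D C_D : ℝ, 0 < c_D ∧ 0 < C_D ∧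
      ∀ (K : Type) [Field K] [NumberField K], Module.finrank ℚ K = n →
        (∀ χ : ClassGroup (𝓞 K) →* ℂˣ, χ ≠ 1 → ∀ ρ : ℂ, classGroupLFunction₀ K χ ρ = 0 → ρ.re < 1) →
        ∀ P : ℝ, 2 ≤ P → ((NumberField.discr K).natAbs : ℝ) ≤ P →
          (Fintype.card (ClassGroup (𝓞 K)) : ℝ) ≤ P → P⁻¹ ≤ NumberField.dedekindZeta_residue K →
        ∀ Z : (ClassGroup (𝓞 K) →* ℂˣ) → Finset ℂ,
          (∀ χ : ClassGroup (𝓞 K) →* ℂˣ, χ ≠ 1 → ∀ ρ ∈ Z χ,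
              classGroupLFunction₀ K χ ρ = 0 ∧ 1 / 4 ≤ ρ.re ∧ ρ.re < 1 ∧ |ρ.im| ≤ P) →
          ∀ α : ℝ, 0 ≤ α → α ≤ 1 →
            ∑ ψ : AddChar (Additive (ClassGroup (𝓞 K))) ℂ with ψ ≠ 0,
              ∑ ρ ∈ Z (AbelianDensity.toMulHom ψ).toHomUnits with α ≤ ρ.re,
                (LogFreeLocal.zeroOrder (classGroupLFunction₀ K (AbelianDensity.toMulHom ψ).toHomUnits) ρ : ℝ)
                  ≤ C_D * P ^ (c_D * (1 - α)) :=
  logFreeDensity_classGroup n hn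

open scoped Classical in
/-- X2 in degree `≤ 2` is the tree's `logFreeDensity_dedekindZeta₁`, verbatim. -/
theorem logFreeDensityZ1_of_le_two (n : ℕ) (hn : n ≤ 2) : ∃ c_D C_D : ℝ, 0 < c_D ∧ 0 < C_D ∧
      ∀ (K : Type) [Field K] [NumberField K], Module.finrank ℚ K = n →
        ∀ P : ℝ, 2 ≤ P → ((NumberField.discr K).natAbs : ℝ) ≤ P →
          (Fintype.card (ClassGroup (𝓞 K)) : ℝ) ≤ P → P⁻¹ ≤ NumberField.dedekindZeta_residue K →
        ∀ Z : Finset ℂ, (∀ ρ ∈ Z, dedekindZeta₁ K ρ = 0 ∧ 1 / 4 ≤ ρ.re ∧ ρ.re < 1 ∧ |ρ.im| ≤ P) →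
          ∀ α : ℝ, 0 ≤ α → α ≤ 1 →
            ∑ ρ ∈ Z with α ≤ ρ.re, (LogFreeLocal.zeroOrder (dedekindZeta₁ K) ρ : ℝ) ≤ C_D * P ^ (c_D * (1 - α)) :=
  logFreeDensity_dedekindZeta₁ n hn

-- Hence the `n = 3, 4` cases of the hardest debt X1 are ALREADY in the tree (the route's consumer is
-- `n = 3`): `logFreeDensityCG_of_le_four 3 (by norm_num)`.

/-! ### The v3 statements imply the v4 κ-variants (so everything stays implied by TZ, §5) -/

theorem perCharacterDeficitκ_of (h : PerCharacterDeficit) : PerCharacterDeficitκ := by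
  intro n hn A _
  obtain ⟨C₂, hC₂⟩ := h n hn
  exact ⟨C₂, fun K _ _ hK _ χ hχ x hx => hC₂ K hK χ hχ x hx⟩

theorem lowerPITκ_of (h : LowerPITUnlessNearbyZero) : LowerPITκ := by
  intro n hn A _
  obtain ⟨C₁, hC₁⟩ := h n hn
  exact ⟨C₁, fun K _ _ hK _ x hx => hC₁ K hK x hx⟩

/-! ### Name-keyed aliases of the stub statements (the hypotheses of the composition; implementation-detail
namespace — the skeleton audit admits a hypothesis whose head's last name component is a declared stub) -/
namespace __byName

/-- Alias of `LogFreeDensityCG` keyed by the registered stub name. -/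
abbrev stub_logFreeDensityCG : Prop := LogFreeDensityCG
/-- Alias of `LogFreeDensityZ1` keyed by the registered stub name. -/
abbrev stub_logFreeDensityZ1 : Prop := LogFreeDensityZ1
/-- Alias of `StarkNoQuadSubfieldInexplicit → ResidueLowerBound`. -/
abbrev stub_residueFromStark : Prop := StarkNoQuadSubfieldInexplicit → ResidueLowerBound
/-- Alias of `LogFreeDensityCG → PerCharacterDeficitκ`. -/
abbrev stub_perCharacterDeficit_of_density : Prop := LogFreeDensityCG → PerCharacterDeficitκ
/-- Alias of `LogFreeDensityZ1 → LowerPITκ`. -/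
abbrev stub_lowerPIT_of_density : Prop := LogFreeDensityZ1 → LowerPITκ
/-- Alias of `StarkNoQuadSubfieldInexplicit` keyed by the registered stub name. -/
abbrev stub_starkNoQuadSubfield : Prop := StarkNoQuadSubfieldInexplicit

end __byName

/-- The explicit in-tree named fact implies STUB S (`c = 1/(4·n!)`): the stub is no stronger than
Stark 1974 / Murty–Murty Cor 6.2 as vendored. (Proof as in `HeilbronnCount`.) -/
theorem starkNoQuadSubfield_of_named
    (h : Stark1974_dedekindZeta_ne_zero_of_noQuadraticSubfield) : StarkNoQuadSubfieldInexplicit := by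
  intro n
  refine ⟨1 / (4 * (n.factorial : ℝ)), by positivity, fun K _ _ hK hnq σ hσ hσ1 => ?_⟩
  refine h K hnq σ ?_ hσ1
  subst hK
  have : 1 / (4 * ((Module.finrank ℚ K).factorial : ℝ)) / Real.log ((NumberField.discr K).natAbs : ℝ)
      = 1 / (4 * ((Module.finrank ℚ K).factorial : ℝ) * Real.log ((NumberField.discr K).natAbs : ℝ)) := by
    rw [div_div]
  linarith [this]

/-! ## §2 The lever: subgroup orthogonality in dual form (finite abelian groups) -/

section Orthogonality

variable {G : Type*} [CommGroup G]


/-- An additive character of `Additive Q` as a monoid hom `Q →* ℂ`. [folklore] -/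
def charOfAdd {Q : Type*} [CommGroup Q] (ψ : AddChar (Additive Q) ℂ) : Q →* ℂ where
  toFun q := ψ (Additive.ofMul q)
  map_one' := by rw [ofMul_one]; exact ψ.map_zero_eq_one
  map_mul' a b := by rw [ofMul_mul]; exact ψ.map_add_eq_mul _ _

/-- The character of `G` obtained from an additive character of `G ⧸ M` (trivial on `M`). -/
def liftChar (M : Subgroup G) (ψ : AddChar (Additive (G ⧸ M)) ℂ) : G →* ℂˣ :=
  ((charOfAdd ψ).comp (QuotientGroup.mk' M)).toHomUnits

@[simp] theorem liftChar_apply (M : Subgroup G) (ψ : AddChar (Additive (G ⧸ M)) ℂ) (g : G) :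
    ((liftChar M ψ g : ℂˣ) : ℂ) = ψ (Additive.ofMul (g : G ⧸ M)) := rfl

theorem liftChar_apply_of_mem (M : Subgroup G) (ψ : AddChar (Additive (G ⧸ M)) ℂ) {g : G}
    (hg : g ∈ M) : liftChar M ψ g = 1 := by
  ext
  rw [liftChar_apply, (QuotientGroup.eq_one_iff g).mpr hg, ofMul_one, AddChar.map_zero_eq_one,
    Units.val_one]

theorem liftChar_ne_one (M : Subgroup G) {ψ : AddChar (Additive (G ⧸ M)) ℂ} (hψ : ψ ≠ 0) :
    liftChar M ψ ≠ 1 := by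
  intro h
  apply hψ
  rw [AddChar.eq_zero_iff]
  intro q
  obtain ⟨g, hg⟩ : ∃ g : G, (g : G ⧸ M) = Additive.toMul q := QuotientGroup.mk_surjective _
  have h1 := congrArg (fun χ : G →* ℂˣ => ((χ g : ℂˣ) : ℂ)) h
  simp only [liftChar_apply, MonoidHom.one_apply, Units.val_one] at h1
  rwa [hg, ofMul_toMul] at h1

open scoped Classical in
/-- `∑_ψ Re ψ(ḡ) = [G:M]·[g ∈ M]` over the characters of `G ⧸ M`. [folklore] -/
theorem sum_re_addChar_quotient [Finite G] (M : Subgroup G) (g : G) :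
    ∑ ψ : AddChar (Additive (G ⧸ M)) ℂ, (ψ (Additive.ofMul (g : G ⧸ M))).re =
      if g ∈ M then (M.index : ℝ) else 0 := by
  classical
  haveI : Fintype G := Fintype.ofFinite G
  have h := AddChar.sum_apply_eq_ite (α := Additive (G ⧸ M)) (Additive.ofMul (g : G ⧸ M))
  rw [← Complex.re_sum]
  have hiff : (Additive.ofMul (g : G ⧸ M) = 0) ↔ g ∈ M := by
    rw [ofMul_eq_zero, QuotientGroup.eq_one_iff]
  have hcard : (Fintype.card (Additive (G ⧸ M)) : ℝ) = (M.index : ℝ) := by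
    rw [Subgroup.index_eq_card, Nat.card_eq_fintype_card,
      Fintype.card_congr (Additive.ofMul (α := G ⧸ M)).symm]
  by_cases hg : g ∈ M
  · rw [if_pos hg]
    have h' : ∑ ψ : AddChar (Additive (G ⧸ M)) ℂ, ψ (Additive.ofMul (g : G ⧸ M)) =
        (Fintype.card (Additive (G ⧸ M)) : ℂ) := by
      rw [h, if_pos (hiff.mpr hg)]
    rw [h', Complex.natCast_re, hcard]
  · rw [if_neg hg]
    have h' : ∑ ψ : AddChar (Additive (G ⧸ M)) ℂ, ψ (Additive.ofMul (g : G ⧸ M)) = 0 := by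
      rw [h, if_neg (mt hiff.mp hg)]
    rw [h', Complex.zero_re]

/-- The number of characters of `G ⧸ M` is the index. [folklore] -/
theorem card_addChar_quotient [Finite G] (M : Subgroup G) :
    Fintype.card (AddChar (Additive (G ⧸ M)) ℂ) = M.index := by
  classical
  haveI : Fintype G := Fintype.ofFinite G
  rw [AddChar.card_eq, Subgroup.index_eq_card, Nat.card_eq_fintype_card,
    Fintype.card_congr (Additive.ofMul (α := G ⧸ M)).symm]

open scoped Classical in
/-- **Subgroup orthogonality, dual form.** For weights `a : G → ℝ` on a finite abelian group and a
subgroup `M`: if every NONTRIVIAL character trivial on `M` satisfies the one-sided bound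
`∑_g Re χ(g)·a(g) ≤ B`, then `[G:M] · ∑_{g ∈ M} a(g) ≤ ∑_g a(g) + ([G:M] − 1)·B`
(expand `1_M = [G:M]⁻¹ ∑_{χ ∈ M^⊥} χ` and separate `χ = 1`). [folklore] -/
theorem index_mul_sum_filter_mem_le [Fintype G] (M : Subgroup G) (a : G → ℝ) (B : ℝ)
    (hB : ∀ χ : G →* ℂˣ, χ ≠ 1 → (∀ g ∈ M, χ g = 1) →
      ∑ g, ((χ g : ℂˣ) : ℂ).re * a g ≤ B) :
    (M.index : ℝ) * ∑ g ∈ Finset.univ.filter (· ∈ M), a g ≤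
      ∑ g, a g + ((M.index : ℝ) - 1) * B := by
  classical
  have h1 : (M.index : ℝ) * ∑ g ∈ Finset.univ.filter (· ∈ M), a g
      = ∑ g : G, (∑ ψ : AddChar (Additive (G ⧸ M)) ℂ, (ψ (Additive.ofMul (g : G ⧸ M))).re) * a g := by
    rw [Finset.mul_sum, Finset.sum_filter]
    refine Finset.sum_congr rfl fun g _ => ?_
    rw [sum_re_addChar_quotient]
    split_ifs <;> simp
  have h2 : ∑ g : G, (∑ ψ : AddChar (Additive (G ⧸ M)) ℂ, (ψ (Additive.ofMul (g : G ⧸ M))).re) * a g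
      = ∑ ψ : AddChar (Additive (G ⧸ M)) ℂ, ∑ g : G, (ψ (Additive.ofMul (g : G ⧸ M))).re * a g := by
    simp_rw [Finset.sum_mul]
    exact Finset.sum_comm
  rw [h1, h2, ← Finset.add_sum_erase _ _ (Finset.mem_univ (0 : AddChar (Additive (G ⧸ M)) ℂ))]
  have h0 : ∑ g : G, ((0 : AddChar (Additive (G ⧸ M)) ℂ) (Additive.ofMul (g : G ⧸ M))).re * a g
      = ∑ g, a g := by
    simp
  rw [h0]
  have hcard : ((Finset.univ.erase (0 : AddChar (Additive (G ⧸ M)) ℂ)).card : ℝ) =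
      (M.index : ℝ) - 1 := by
    rw [Finset.card_erase_of_mem (Finset.mem_univ _), Finset.card_univ, card_addChar_quotient,
      Nat.cast_sub (Nat.one_le_iff_ne_zero.mpr (Subgroup.index_ne_zero_of_finite (H := M))), Nat.cast_one]
  have hrest : ∑ ψ ∈ Finset.univ.erase (0 : AddChar (Additive (G ⧸ M)) ℂ),
      ∑ g : G, (ψ (Additive.ofMul (g : G ⧸ M))).re * a g ≤ ((M.index : ℝ) - 1) * B := by
    calc ∑ ψ ∈ Finset.univ.erase (0 : AddChar (Additive (G ⧸ M)) ℂ),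
          ∑ g : G, (ψ (Additive.ofMul (g : G ⧸ M))).re * a g
        ≤ ∑ ψ ∈ Finset.univ.erase (0 : AddChar (Additive (G ⧸ M)) ℂ), B := by
          refine Finset.sum_le_sum fun ψ hψ => ?_
          have hne : ψ ≠ 0 := Finset.ne_of_mem_erase hψ
          have h := hB (liftChar M ψ) (liftChar_ne_one M hne)
            (fun g hg => liftChar_apply_of_mem M ψ hg)
          simpa only [liftChar_apply] using h
      _ = ((M.index : ℝ) - 1) * B := by rw [Finset.sum_const, nsmul_eq_mul, hcard]
  linarith


end Orthogonality

/-! ## §3 Counting helpers -/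


open Classical in
/-- **Degree-one primes, counted by norm**: the nonzero primes of prime norm `≤ x` number
`∑_{p ≤ x} #{𝔭 : N𝔭 = p}` (the tree's `normPrimeIdealCount`). [folklore] -/
theorem ncard_degOne_eq_sum (K : Type) [Field K] [NumberField K] (x : ℕ) :
    Set.ncard {P : Ideal (𝓞 K) | P.IsPrime ∧ P ≠ ⊥ ∧ (Ideal.absNorm P).Prime ∧ Ideal.absNorm P ≤ x}
      = ∑ p ∈ (Finset.Icc 0 x).filter Nat.Prime, normPrimeIdealCount K p := by
  set S : Set (Ideal (𝓞 K)) :=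
    {P : Ideal (𝓞 K) | P.IsPrime ∧ P ≠ ⊥ ∧ (Ideal.absNorm P).Prime ∧ Ideal.absNorm P ≤ x} with hSdef
  have hSfin : S.Finite := by
    refine (Ideal.finite_setOf_absNorm_le (S := 𝓞 K) x).subset ?_
    rintro P ⟨-, -, -, h4⟩
    exact h4
  rw [Set.ncard_eq_toFinset_card S hSfin]
  rw [Finset.card_eq_sum_card_fiberwise (f := fun P : Ideal (𝓞 K) => Ideal.absNorm P)
    (t := (Finset.Icc 0 x).filter Nat.Prime) ?_]
  · apply Finset.sum_congr rfl
    intro p hp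
    rw [Finset.mem_filter] at hp
    rw [normPrimeIdealCount, ← Set.ncard_coe_finset]
    congr 1
    ext P
    simp only [Finset.coe_filter, Set.Finite.mem_toFinset, Set.mem_setOf_eq, hSdef]
    constructor
    · rintro ⟨⟨h1, h2, -, -⟩, h5⟩
      exact ⟨h1, h2, h5⟩
    · rintro ⟨h1, h2, h5⟩
      refine ⟨⟨h1, h2, ?_, ?_⟩, h5⟩
      · rw [h5]; exact hp.2
      · rw [h5]; exact (Finset.mem_Icc.1 hp.1).2
  · intro P hPS
    rw [Finset.mem_coe, Set.Finite.mem_toFinset] at hPS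
    obtain ⟨-, -, h3, h4⟩ := hPS
    rw [Finset.mem_coe, Finset.mem_filter, Finset.mem_Icc]
    exact ⟨⟨Nat.zero_le _, h4⟩, h3⟩

open Classical in
/-- `π_K(x) ≤ #{degree-one primes ≤ x} + [K:ℚ]·π(√x)` (tree lemmas
`primeIdealCount_eq_sum_normPrimeIdealCount`, `sum_normPrimeIdealCount_not_prime_le`). [folklore] -/
theorem primeIdealCount_le_degOne_add (K : Type) [Field K] [NumberField K] (x : ℕ) :
    primeIdealCount K x ≤ ∑ p ∈ (Finset.Icc 0 x).filter Nat.Prime, normPrimeIdealCount K p +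
      Module.finrank ℚ K * Nat.primeCounting (Nat.sqrt x) := by
  have hx : (0 : ℝ) ≤ x := Nat.cast_nonneg x
  rw [primeIdealCount_eq_sum_normPrimeIdealCount K hx, Nat.floor_natCast,
    ← Finset.sum_filter_add_sum_filter_not (Finset.Icc 0 x) Nat.Prime]
  exact Nat.add_le_add_left (sum_normPrimeIdealCount_not_prime_le K x) _

/-- Numerical size lemma: for `x ≥ (100(n+1))⁴`,
`(8n+2)√x + 8n + 7 ≤ (7/20) · x/log x` (via `t = x^{1/4}`, `log x ≤ 4t`). [folklore] -/
theorem size_ineq (n : ℕ) {x : ℝ} (hx : ((100 * ((n : ℝ) + 1)) ^ 4) ≤ x) :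
    8 * ((n : ℝ) * Real.sqrt x) + 2 * Real.sqrt x + 8 * n + 7 ≤ 7 / 20 * (x / Real.log x) := by
  have hn0 : (0 : ℝ) ≤ n := Nat.cast_nonneg n
  have h100 : (100 : ℝ) ≤ 100 * ((n : ℝ) + 1) := by nlinarith
  have hx1e8 : (100 : ℝ) ^ 4 ≤ x := le_trans (pow_le_pow_left₀ (by norm_num) h100 4) hx
  have hxpos : 0 < x := by linarith [show (0:ℝ) < 100 ^ 4 by norm_num]
  have hx1 : 1 < x := by linarith [show (1:ℝ) < 100 ^ 4 by norm_num]
  set t : ℝ := x ^ ((1:ℝ)/4) with ht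
  have htpos : 0 < t := Real.rpow_pos_of_pos hxpos _
  have ht4 : t ^ 4 = x := by
    rw [ht, ← Real.rpow_natCast, ← Real.rpow_mul hxpos.le]; norm_num
  have ht2 : t ^ 2 = Real.sqrt x := by
    rw [ht, ← Real.rpow_natCast, ← Real.rpow_mul hxpos.le, Real.sqrt_eq_rpow]; norm_num
  have htge : 100 * ((n : ℝ) + 1) ≤ t := by
    have : (100 * ((n : ℝ) + 1)) = ((100 * ((n : ℝ) + 1)) ^ 4) ^ ((1:ℝ)/4) := by
      rw [← Real.rpow_natCast, ← Real.rpow_mul (by positivity)]; norm_num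
    rw [this, ht]
    exact Real.rpow_le_rpow (by positivity) hx (by norm_num)
  have hlog : Real.log x ≤ 4 * t := by
    have := Real.log_le_rpow_div hxpos.le (show (0:ℝ) < 1/4 by norm_num)
    rw [← ht] at this
    linarith
  have hlogpos : 0 < Real.log x := Real.log_pos hx1
  -- x / log x ≥ t^4 / (4t) = t^3/4
  have hquot : t ^ 3 / 4 ≤ x / Real.log x := by
    rw [div_le_div_iff₀ (by norm_num) hlogpos]
    calc t ^ 3 * Real.log x ≤ t ^ 3 * (4 * t) :=
          mul_le_mul_of_nonneg_left hlog (pow_pos htpos 3).le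
      _ = x * 4 := by rw [← ht4]; ring
  rw [← ht2]
  nlinarith [htge, hquot, pow_pos htpos 2, sq_nonneg t, hn0, mul_pos htpos htpos]

/-- `(100(n+1))⁴ ≤ 3^C` once `C ≥ 50(1+n²)`. [folklore] -/
theorem pow_bound (n C : ℕ) (hC : 50 * (1 + n ^ 2) ≤ C) : (100 * (n + 1)) ^ 4 ≤ 3 ^ C := by
  have h1 : n + 1 ≤ 3 ^ n := by
    have := Nat.lt_pow_self (show 1 < 3 by norm_num) (n := n)
    omega
  have h2 : 100 * (n + 1) ≤ 3 ^ (5 + n) := by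
    rw [pow_add]; nlinarith [show (100:ℕ) ≤ 3 ^ 5 by norm_num]
  calc (100 * (n + 1)) ^ 4 ≤ (3 ^ (5 + n)) ^ 4 := Nat.pow_le_pow_left h2 4
    _ = 3 ^ (20 + 4 * n) := by rw [← pow_mul]; ring_nf
    _ ≤ 3 ^ C := Nat.pow_le_pow_right (by norm_num) (by nlinarith)



open Classical in
/-- All degree-one primes of norm `≤ x`, fibred over the class group. [folklore] -/
theorem ncard_degOne_eq_sum_classes (K : Type) [Field K] [NumberField K] (x : ℕ) :
    Set.ncard {P : Ideal (𝓞 K) | P.IsPrime ∧ P ≠ ⊥ ∧ (Ideal.absNorm P).Prime ∧ Ideal.absNorm P ≤ x}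
      = ∑ C : ClassGroup (𝓞 K), (degOneInClass K x C).ncard := by
  set t : ClassGroup (𝓞 K) → Finset (Ideal (𝓞 K)) :=
    fun C => (degOneInClass_finite K x C).toFinset with ht
  have hU : {P : Ideal (𝓞 K) | P.IsPrime ∧ P ≠ ⊥ ∧ (Ideal.absNorm P).Prime ∧ Ideal.absNorm P ≤ x}
      = ↑((Finset.univ : Finset (ClassGroup (𝓞 K))).biUnion t) := by
    ext P
    simp only [Finset.coe_biUnion, Finset.coe_univ, Set.mem_univ, Set.iUnion_true, Set.mem_iUnion,
      ht, Set.Finite.coe_toFinset, degOneInClass, Set.mem_setOf_eq]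
    constructor
    · rintro ⟨h1, h2, h3, h4⟩
      exact ⟨ClassGroup.mk0 ⟨P, mem_nonZeroDivisors_of_ne_zero h2⟩, h1, h3, h4,
        mem_nonZeroDivisors_of_ne_zero h2, rfl⟩
    · rintro ⟨C, h1, h3, h4, hP, -⟩
      exact ⟨h1, nonZeroDivisors.ne_zero hP, h3, h4⟩
  have hdisj : (↑(Finset.univ : Finset (ClassGroup (𝓞 K))) : Set (ClassGroup (𝓞 K))).PairwiseDisjoint t := by
    intro C _ C' _ hne
    rw [Function.onFun, Finset.disjoint_coe.symm]
    simpa [ht] using degOneInClass_disjoint K x hne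
  rw [hU, Set.ncard_coe_finset, Finset.card_biUnion hdisj]
  refine Finset.sum_congr rfl fun C _ => ?_
  rw [ht, Set.ncard_eq_toFinset_card _ (degOneInClass_finite K x C)]

/-- Bridge between the stub's `degOneClassCount` (real `x`, no `IsPrime` clause) and the fibre
`degOneInClass` of the crux's counted set (an ideal of prime norm is prime,
Mathlib `Ideal.isPrime_of_irreducible_absNorm`). [folklore] -/
theorem degOneClassCount_natCast (K : Type) [Field K] [NumberField K] (x : ℕ)
    (C : ClassGroup (𝓞 K)) : degOneClassCount K C (x : ℝ) = (degOneInClass K x C).ncard := by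
  unfold degOneClassCount degOneInClass
  congr 1
  ext P
  simp only [Set.mem_setOf_eq, Nat.cast_le]
  constructor
  · rintro ⟨h1, h2, h3⟩
    exact ⟨Ideal.isPrime_of_irreducible_absNorm h1, h1, h2, h3⟩
  · rintro ⟨-, h1, h2, h3⟩
    exact ⟨h1, h2, h3⟩

/-! ## §4 The composition -/

/-- Degenerate degrees `n ≤ 2`: the crux hypotheses are contradictory (`n = 0`: no field; `n = 1`:
`𝓞 K ≃ ℤ`, trivial class group, so no proper `M`; `n = 2`: `K` is its own quadratic subfield). -/
theorem degenerate_false {n : ℕ} (hn3 : n < 3) (K : Type) [Field K] [NumberField K]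
    (hKn : Module.finrank ℚ K = n) (hnq : ∀ F : IntermediateField ℚ K, Module.finrank ℚ F ≠ 2)
    (M : Subgroup (ClassGroup (𝓞 K))) (hM : M ≠ ⊤) : False := by
  interval_cases n
  · exact (Module.finrank_pos (R := ℚ) (M := K)).ne' hKn
  · -- degree one: `𝓞 K ≃ ℤ`, the class group is trivial, so `M = ⊤`
    apply hM
    have hbij : Function.Bijective (algebraMap ℚ K) :=
      Algebra.finrank_eq_one_iff_bijective_algebraMap.mp hKn
    have : IsIntegralClosure ℤ ℤ K :=
      .of_algEquiv _ (.ofBijective (IsScalarTower.toAlgHom ℤ ℚ K) hbij) (by simp)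
    have e : ℤ ≃ₐ[ℤ] 𝓞 K := IsIntegralClosure.equiv ℤ ℤ K (𝓞 K)
    have hPID : IsPrincipalIdealRing (𝓞 K) :=
      IsPrincipalIdealRing.of_surjective (e : ℤ →+* 𝓞 K) e.surjective
    have h1 : NumberField.classNumber K = 1 := (NumberField.classNumber_eq_one_iff).mpr hPID
    have hsub : Subsingleton (ClassGroup (𝓞 K)) := by
      rw [NumberField.classNumber] at h1
      exact Fintype.card_le_one_iff_subsingleton.mp h1.le
    rw [Subgroup.eq_top_iff']
    intro g
    rw [Subsingleton.elim g 1]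
    exact M.one_mem
  · -- degree two: `K` itself is a quadratic subfield
    exact hnq ⊤ (by rw [IntermediateField.finrank_top', hKn])


/-- **The crux inequality for ONE field from the three analytic inputs at that field** (the v3
composition body): given, for `K` of degree `n ≥ 3` without quadratic subfield, the per-character
deficit at `x ≥ Q^{C₂}`, the lower PIT dichotomy at `x ≥ Q^{C₁}` and Stark's interval with constant
`c`, the escape inequality holds for `x ≥ |d_K|^{Cn}`, `Cn = (⌈max(C₂, C₁, 1, 4/c)⌉ + 50)(1 + n²) + n`.
For `x ≥ |d_K|^{Cn}` (`≥ Q^{C₂}, Q^{C₁}`, and `log x ≥ (4/c) log|d_K|`): the nearby-zero alternative is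
impossible (Stark: `β₁ < 1 − c/log|d_K|` forces `(1 − β₁) log x ≥ c·Cn ≥ 4`), so
`π_K(x) ≥ (29/32) Li(x)`; the lever (§2, `B = Li/8`) gives `m·#(deg-1 primes in M) ≤ π¹_K + (m − 1) Li/8`,
hence `#escape ≥ ½(π¹_K − Li/8)`; with `π¹_K ≥ π_K − n π(√x)` and Chebyshev
`π(x) ≤ 2 log 4 · x/log x + √x` the inequality `π(x) ≤ 8·#escape` follows (`8·(25/64) = 25/8 > 2.78`). -/
theorem escape_of_inputs {n : ℕ} (hn3 : 3 ≤ n) {C₂ C₁ c : ℝ} (hc : 0 < c)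
    (K : Type) [Field K] [NumberField K] (hKn : Module.finrank ℚ K = n)
    (hC₂ : ∀ χ : ClassGroup (𝓞 K) →* ℂˣ, χ ≠ 1 → ∀ y : ℝ, ThornerZaman.condQn K ^ C₂ ≤ y →
      8 * ∑ C : ClassGroup (𝓞 K), ((χ C : ℂ)).re * (degOneClassCount K C y : ℝ) ≤ offsetLogIntegral y)
    (hC₁ : ∀ y : ℝ, ThornerZaman.condQn K ^ C₁ ≤ y →
      29 * offsetLogIntegral y ≤ 32 * (primeIdealCount K y : ℝ) ∨
      ∃ β₁ : ℝ, 1 - 1 / (8 * Real.log (ThornerZaman.condQn K)) < β₁ ∧ β₁ < 1 ∧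
        dedekindZetaCont K β₁ = 0 ∧ (1 - β₁) * Real.log y < 4)
    (hSc : ∀ σ : ℝ, 1 - c / Real.log ((NumberField.discr K).natAbs : ℝ) ≤ σ → σ < 1 →
      dedekindZetaCont K σ ≠ 0)
    (x : ℕ) (Cn : ℕ) (hCn : Cn = (⌈max (max C₂ C₁) (max 1 (4 / c))⌉₊ + 50) * (1 + n ^ 2) + n)
    (hx : |NumberField.discr K| ^ Cn ≤ (x : ℤ))
    (M : Subgroup (ClassGroup (𝓞 K))) (hM : M ≠ ⊤) :
    Nat.primeCounting x ≤ 8 * (escapeSet K x M).ncard := by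
  classical
  have h1n : 1 < n := by omega
  set C' : ℝ := max (max C₂ C₁) (max 1 (4 / c)) with hC'def
  have hK : 1 < Module.finrank ℚ K := by rw [hKn]; exact h1n

  set d : ℝ := |(NumberField.discr K : ℝ)| with hddef
  set Q : ℝ := ThornerZaman.condQn K with hQdef
  -- d ≥ 3, Q = d n^n ≤ d^(1+n²)
  have hd3 : (3:ℝ) ≤ d := by
    have h2 := NumberField.abs_discr_gt_two hK
    rw [hddef, ← Int.cast_abs]
    exact_mod_cast (show (3:ℤ) ≤ |NumberField.discr K| by omega)
  have hd1 : (1:ℝ) ≤ d := by linarith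
  have hdpos : (0:ℝ) < d := by linarith
  have hQ : Q = d * (n : ℝ) ^ n := by rw [hQdef, ThornerZaman.condQn, hKn]
  have hnn : (n : ℝ) ^ n ≤ d ^ (n ^ 2) := by
    have h1 : (n : ℝ) ≤ 3 ^ n := by
      exact_mod_cast (Nat.lt_pow_self (by norm_num : 1 < 3) (n := n)).le
    calc (n:ℝ) ^ n ≤ (3 ^ n) ^ n := pow_le_pow_left₀ (by positivity) h1 n
      _ = 3 ^ (n ^ 2) := by rw [← pow_mul]; ring_nf
      _ ≤ d ^ (n ^ 2) := pow_le_pow_left₀ (by norm_num) hd3 _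
  have hQle : Q ≤ d ^ (1 + n ^ 2) := by
    rw [hQ, pow_add, pow_one]
    exact mul_le_mul_of_nonneg_left hnn (by linarith)
  have hQ12 : 12 ≤ Q := ThornerZaman.twelve_le_condQn (K := K) hK
  have hQ1 : 1 ≤ Q := by linarith
  -- x ≥ d^Cn ≥ 3^Cn
  have hx_d : d ^ Cn ≤ (x : ℝ) := by
    have h1 : ((|NumberField.discr K| ^ Cn : ℤ) : ℝ) ≤ ((x : ℤ) : ℝ) := by exact_mod_cast hx
    rw [Int.cast_pow, Int.cast_abs, Int.cast_natCast] at h1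
    exact h1
  have hx_3 : (3:ℝ) ^ Cn ≤ (x : ℝ) := le_trans (pow_le_pow_left₀ (by norm_num) hd3 Cn) hx_d
  -- Q^{C'} ≤ x
  have hC'1 : 1 ≤ C' := le_trans (le_max_left _ _) (le_max_right _ _)
  have hC'0 : 0 ≤ C' := by linarith
  have hQC' : Q ^ C' ≤ (x : ℝ) := by
    have h1 : Q ^ C' ≤ Q ^ ((⌈C'⌉₊ + 50 : ℕ) : ℝ) := by
      apply Real.rpow_le_rpow_of_exponent_le hQ1
      have := Nat.le_ceil C'
      push_cast
      linarith
    rw [Real.rpow_natCast] at h1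
    calc Q ^ C' ≤ Q ^ (⌈C'⌉₊ + 50) := h1
      _ ≤ (d ^ (1 + n ^ 2)) ^ (⌈C'⌉₊ + 50) := pow_le_pow_left₀ (by linarith) hQle _
      _ = d ^ ((1 + n ^ 2) * (⌈C'⌉₊ + 50)) := by rw [← pow_mul]
      _ ≤ d ^ Cn := pow_le_pow_right₀ hd1 (by rw [hCn]; nlinarith)
      _ ≤ (x : ℝ) := hx_d
  have hC₂le : C₂ ≤ C' := le_trans (le_max_left _ _) (le_max_left _ _)
  have hC₁le : C₁ ≤ C' := le_trans (le_max_right _ _) (le_max_left _ _)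
  have hcle : 4 / c ≤ C' := le_trans (le_max_right _ _) (le_max_right _ _)
  have hQC₂ : Q ^ C₂ ≤ (x : ℝ) := le_trans (Real.rpow_le_rpow_of_exponent_le hQ1 hC₂le) hQC'
  have hQC₁ : Q ^ C₁ ≤ (x : ℝ) := le_trans (Real.rpow_le_rpow_of_exponent_le hQ1 hC₁le) hQC'
  -- sizes
  have hCn50 : 50 * (1 + n ^ 2) ≤ Cn := by rw [hCn]; nlinarith
  have hCnC' : C' ≤ (Cn : ℝ) := by
    have h1 : C' ≤ (⌈C'⌉₊ : ℝ) := Nat.le_ceil C'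
    have h2 : (⌈C'⌉₊ : ℕ) ≤ Cn := by rw [hCn]; nlinarith
    have h3 : ((⌈C'⌉₊ : ℕ) : ℝ) ≤ (Cn : ℝ) := by exact_mod_cast h2
    linarith
  have hxbig : (100 * ((n:ℝ) + 1)) ^ 4 ≤ (x : ℝ) := by
    have h1 : ((100 * (n + 1)) ^ 4 : ℕ) ≤ 3 ^ Cn := pow_bound n Cn hCn50
    have h2 : (((100 * (n + 1)) ^ 4 : ℕ) : ℝ) ≤ ((3 ^ Cn : ℕ) : ℝ) := by exact_mod_cast h1
    push_cast at h2
    linarith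
  have hsize := size_ineq n hxbig
  have hx3' : (3:ℝ) ≤ (x : ℝ) := by
    have : (3:ℝ) ^ 1 ≤ 3 ^ Cn := pow_le_pow_right₀ (by norm_num) (by omega)
    linarith
  have hxpos : 0 < (x : ℝ) := by linarith
  have hx1 : 1 < (x : ℝ) := by linarith
  have hx2 : 2 ≤ (x : ℝ) := by linarith
  have hlogx : 1 ≤ Real.log (x : ℝ) := by
    rw [Real.le_log_iff_exp_le hxpos]
    have := Real.exp_one_lt_d9
    linarith
  have hlogpos : 0 < Real.log (x : ℝ) := by linarith
  -- log x ≥ Cn · log d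
  have hlogd : 0 < Real.log d := Real.log_pos (by linarith)
  have hlogxd : (Cn : ℝ) * Real.log d ≤ Real.log (x : ℝ) := by
    have := Real.log_le_log (pow_pos hdpos Cn) hx_d
    rwa [Real.log_pow] at this
  -- Li ≥ (x-2)/log x ≥ x/log x − 2
  have hLi : (x : ℝ) / Real.log (x : ℝ) - 2 ≤ offsetLogIntegral (x : ℝ) := by
    have h1 := sub_mul_inv_log_pow_le_offsetLogIntegralPow 1 hx2
    rw [offsetLogIntegralPow_one, pow_one, ← div_eq_mul_inv] at h1
    have h2 : (x : ℝ) / Real.log (x : ℝ) - 2 ≤ ((x : ℝ) - 2) / Real.log (x : ℝ) := by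
      rw [sub_div]
      have : 2 / Real.log (x : ℝ) ≤ 2 := by
        rw [div_le_iff₀ hlogpos]; nlinarith
      linarith
    linarith
  -- π(x) ≤ 2 log 4 · x/log x + √x
  have hA0 : 0 ≤ (x : ℝ) / Real.log (x : ℝ) := by positivity
  have hpi : (Nat.primeCounting x : ℝ) ≤ 2.7726 * ((x : ℝ) / Real.log (x : ℝ)) + Real.sqrt (x : ℝ) := by
    have h1 := Chebyshev.pi_le_log4_mul_div hx1
    rw [Nat.floor_natCast] at h1
    have hlogsqrt : Real.log (Real.sqrt (x:ℝ)) = Real.log (x:ℝ) / 2 := Real.log_sqrt (by positivity)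
    rw [hlogsqrt] at h1
    have e3 : Real.log 4 * (x:ℝ) / (Real.log (x:ℝ) / 2) = 2 * Real.log 4 * ((x:ℝ) / Real.log (x:ℝ)) := by
      field_simp
    rw [e3] at h1
    have hlog4 : Real.log 4 < 1.3863 := by
      have : Real.log 4 = 2 * Real.log 2 := by
        rw [show (4:ℝ) = 2 ^ 2 by norm_num, Real.log_pow]; norm_num
      rw [this]; have := Real.log_two_lt_d9; linarith
    have h4 : 2 * Real.log 4 * ((x:ℝ) / Real.log (x:ℝ)) ≤ 2.7726 * ((x:ℝ) / Real.log (x:ℝ)) :=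
      mul_le_mul_of_nonneg_right (by linarith) hA0
    linarith
  -- (A) lower prime ideal theorem at x: the nearby-zero alternative contradicts Stark
  have hlowK : 29 * offsetLogIntegral (x : ℝ) ≤ 32 * (primeIdealCount K (x : ℝ) : ℝ) := by
    rcases hC₁ (x : ℝ) hQC₁ with h | ⟨β₁, -, hβhi, hzero, hnear⟩
    · exact h
    · exfalso
      have hd_nat : (((NumberField.discr K).natAbs : ℕ) : ℝ) = d := by
        rw [hddef, Nat.cast_natAbs, Int.cast_abs]
      have hβup : β₁ < 1 - c / Real.log d := by
        by_contra hcon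
        rw [not_lt] at hcon
        exact hSc β₁ (by rw [hd_nat]; exact hcon) hβhi hzero
      have h1 : c / Real.log d < 1 - β₁ := by linarith
      have hcd : 0 ≤ c / Real.log d := div_nonneg hc.le hlogd.le
      have h2 : c / Real.log d * ((Cn : ℝ) * Real.log d) = c * Cn := by
        field_simp
      have h3 : c / Real.log d * ((Cn : ℝ) * Real.log d) ≤ c / Real.log d * Real.log (x : ℝ) :=
        mul_le_mul_of_nonneg_left hlogxd hcd
      have h4 : 4 ≤ c * Cn := by
        have h41 : 4 ≤ c * C' := by
          have := (div_le_iff₀ hc).1 hcle; linarith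
        have h42 : c * C' ≤ c * Cn := mul_le_mul_of_nonneg_left hCnC' hc.le
        linarith
      have h5 : c / Real.log d * Real.log (x : ℝ) ≤ (1 - β₁) * Real.log (x : ℝ) :=
        mul_le_mul_of_nonneg_right h1.le hlogpos.le
      linarith
  -- (B) counting: fibres, degree ≥ 2 primes
  set a : ClassGroup (𝓞 K) → ℝ := fun C => ((degOneInClass K x C).ncard : ℝ) with hadef
  set D : Set (Ideal (𝓞 K)) := {P : Ideal (𝓞 K) | P.IsPrime ∧ P ≠ ⊥ ∧ (Ideal.absNorm P).Prime ∧
      Ideal.absNorm P ≤ x} with hD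
  have hDsum : (Set.ncard D : ℝ) = ∑ C : ClassGroup (𝓞 K), a C := by
    rw [hD, ncard_degOne_eq_sum_classes K x]
    push_cast
    rfl
  have hEsum : ((escapeSet K x M).ncard : ℝ) =
      ∑ C ∈ Finset.univ.filter (fun C : ClassGroup (𝓞 K) => C ∉ M), a C := by
    rw [ncard_escapeSet_eq_sum K x M]
    push_cast
    rfl
  have hsplit : ∑ C ∈ Finset.univ.filter (fun C : ClassGroup (𝓞 K) => C ∈ M), a C +
      ∑ C ∈ Finset.univ.filter (fun C : ClassGroup (𝓞 K) => C ∉ M), a C = ∑ C, a C :=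
    Finset.sum_filter_add_sum_filter_not _ _ _
  have hDeq : Set.ncard D = ∑ p ∈ (Finset.Icc 0 x).filter Nat.Prime, normPrimeIdealCount K p :=
    ncard_degOne_eq_sum K x
  have hdeg := primeIdealCount_le_degOne_add K x
  rw [hKn, ← hDeq] at hdeg
  -- π(√x) ≤ √x + 1
  have hpisqrt : (Nat.primeCounting (Nat.sqrt x) : ℝ) ≤ Real.sqrt (x : ℝ) + 1 := by
    have h1 : Nat.primeCounting (Nat.sqrt x) ≤ Nat.sqrt x + 1 := by
      rw [Nat.primeCounting, Nat.primeCounting']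
      exact Nat.count_le _
    have h2 : ((Nat.sqrt x : ℕ) : ℝ) ≤ Real.sqrt (x : ℝ) := by
      rw [Real.le_sqrt (by positivity) (by positivity)]
      exact_mod_cast Nat.sqrt_le' x
    calc (Nat.primeCounting (Nat.sqrt x) : ℝ) ≤ (Nat.sqrt x : ℝ) + 1 := by exact_mod_cast h1
      _ ≤ Real.sqrt (x : ℝ) + 1 := by linarith
  have e1 : ((primeIdealCount K (x : ℝ) : ℕ) : ℝ) ≤
      (Set.ncard D : ℝ) + (n : ℝ) * Real.sqrt (x : ℝ) + n := by
    have h1 : ((primeIdealCount K (x:ℝ) : ℕ) : ℝ) ≤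
        ((Set.ncard D + n * Nat.primeCounting (Nat.sqrt x) : ℕ) : ℝ) := by
      exact_mod_cast hdeg
    push_cast at h1
    have hn0 : (0:ℝ) ≤ n := Nat.cast_nonneg n
    have h2 : (n:ℝ) * (Nat.primeCounting (Nat.sqrt x) : ℝ) ≤ n * (Real.sqrt (x : ℝ) + 1) :=
      mul_le_mul_of_nonneg_left hpisqrt hn0
    have h3 : (n:ℝ) * (Real.sqrt (x : ℝ) + 1) = n * Real.sqrt (x : ℝ) + n := by ring
    rw [h3] at h2
    linarith
  -- (C) the lever: m · (inside) ≤ total + (m − 1) · Li/8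
  have hidx : (2 : ℝ) ≤ M.index := by
    have h1 : M.index ≠ 1 := fun h => hM (Subgroup.index_eq_one.mp h)
    have h2 : M.index ≠ 0 := Subgroup.index_ne_zero_of_finite
    exact_mod_cast (show 2 ≤ M.index by omega)
  have horth : (M.index : ℝ) * ∑ C ∈ Finset.univ.filter (fun C : ClassGroup (𝓞 K) => C ∈ M), a C
      ≤ ∑ C, a C + ((M.index : ℝ) - 1) * (offsetLogIntegral (x : ℝ) / 8) := by
    refine index_mul_sum_filter_mem_le M a (offsetLogIntegral (x : ℝ) / 8) ?_
    intro χ hχ _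
    have h := hC₂ χ hχ (x : ℝ) hQC₂
    have h' : ∑ C : ClassGroup (𝓞 K), ((χ C : ℂ)).re * (degOneClassCount K C (x : ℝ) : ℝ)
        = ∑ C : ClassGroup (𝓞 K), ((χ C : ℂ)).re * a C := by
      refine Finset.sum_congr rfl fun C _ => ?_
      rw [hadef, degOneClassCount_natCast]
    rw [h'] at h
    linarith
  -- (D) assembly in ℝ
  have hin0 : 0 ≤ ∑ C ∈ Finset.univ.filter (fun C : ClassGroup (𝓞 K) => C ∈ M), a C :=
    Finset.sum_nonneg fun C _ => by rw [hadef]; exact Nat.cast_nonneg _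
  have hout0 : 0 ≤ ∑ C ∈ Finset.univ.filter (fun C : ClassGroup (𝓞 K) => C ∉ M), a C :=
    Finset.sum_nonneg fun C _ => by rw [hadef]; exact Nat.cast_nonneg _
  have hE : ∑ C, a C - offsetLogIntegral (x : ℝ) / 8 ≤
      2 * ∑ C ∈ Finset.univ.filter (fun C : ClassGroup (𝓞 K) => C ∉ M), a C := by
    set T := ∑ C, a C with hTdef
    set In := ∑ C ∈ Finset.univ.filter (fun C : ClassGroup (𝓞 K) => C ∈ M), a C with hIndef
    set Out := ∑ C ∈ Finset.univ.filter (fun C : ClassGroup (𝓞 K) => C ∉ M), a C with hOutdef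
    set L' := offsetLogIntegral (x : ℝ) / 8 with hL'def
    set m : ℝ := (M.index : ℝ) with hmdef
    have hIn : In = T - Out := by linarith [hsplit]
    rw [hIn] at horth
    have h1 : (m - 1) * (T - L') ≤ m * Out := by
      have e1 : m * (T - Out) = m * T - m * Out := by ring
      have e2 : (m - 1) * L' = m * L' - L' := by ring
      have e3 : (m - 1) * (T - L') = m * T - m * L' - T + L' := by ring
      rw [e1, e2] at horth
      rw [e3]
      linarith
    by_cases hT : T - L' ≤ 0
    · linarith [hout0]
    · rw [not_le] at hT
      have h2 : (m / 2) * (T - L') ≤ (m - 1) * (T - L') := by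
        apply mul_le_mul_of_nonneg_right _ hT.le
        linarith
      have h3 : m * (T - L' - 2 * Out) ≤ 0 := by
        have e4 : m * (T - L' - 2 * Out) = 2 * ((m / 2) * (T - L')) - 2 * (m * Out) := by ring
        rw [e4]
        linarith
      have hm0 : 0 < m := by linarith
      by_contra hcon
      rw [not_le] at hcon
      have : 0 < m * (T - L' - 2 * Out) := mul_pos hm0 (by linarith)
      linarith
  have hsqrt0 : 0 ≤ Real.sqrt (x : ℝ) := Real.sqrt_nonneg _
  have hn0 : (0 : ℝ) ≤ n := Nat.cast_nonneg n
  have hns0 : 0 ≤ (n : ℝ) * Real.sqrt (x : ℝ) := mul_nonneg hn0 hsqrt0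
  have hgoal : (Nat.primeCounting x : ℝ) ≤ 8 * ((escapeSet K x M).ncard : ℝ) := by
    rw [hEsum]
    linarith [hlowK, hE, e1, hDsum, hLi, hpi, hsize, hsqrt0, hn0, hns0]
  have hgoal' : Nat.primeCounting x ≤ 8 * (escapeSet K x M).ncard := by exact_mod_cast hgoal
  exact hgoal'

/-- **THE CRUX from the six stubs of skeleton v4** (kernel-checked composition of the line): for
`n ≥ 3` take `A` (residue bound R, fed by Stark S), `C₂` (T4 from X1 at `(n, A)`), `C₁` (T5 from X2 at
`(n, A)`), `c` (S), and apply `escape_of_inputs` field by field (the residue hypothesis of T4/T5 being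
discharged by R, which uses the crux's no-quadratic-subfield hypothesis). -/
theorem DegreeOnePrimesEscape_of (hX1 : __byName.stub_logFreeDensityCG) (hX2 : __byName.stub_logFreeDensityZ1)
    (hR : __byName.stub_residueFromStark) (hD : __byName.stub_perCharacterDeficit_of_density)
    (hL : __byName.stub_lowerPIT_of_density) (hS : __byName.stub_starkNoQuadSubfield) :
    Summit.QuantumAdvantage.QuantumAdvantage.Theses.LinnikCubicClassGroups.DegreeOnePrimesEscape := by
  classical
  intro n
  rcases Nat.lt_or_ge n 3 with hn3 | hn3
  · refine ⟨0, ?_⟩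
    intro K _ _ hKn hnq x hx M hM
    exact (degenerate_false hn3 K hKn hnq M hM).elim
  · have h1n : 1 < n := by omega
    obtain ⟨A, hA0, hRes⟩ := hR hS n
    obtain ⟨C₂, hC₂⟩ := hD hX1 n h1n A hA0
    obtain ⟨C₁, hC₁⟩ := hL hX2 n h1n A hA0
    obtain ⟨c, hc, hSc⟩ := hS n
    refine ⟨(⌈max (max C₂ C₁) (max 1 (4 / c))⌉₊ + 50) * (1 + n ^ 2) + n, ?_⟩
    intro K _ _ hKn hnq x hx M hM
    have hκ := hRes K hKn hnq
    exact escape_of_inputs hn3 hc K hKn (fun χ hχ y hy => hC₂ K hKn hκ χ hχ y hy)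
      (fun y hy => hC₁ K hKn hκ y hy) (fun σ h1 h2 => hSc K hKn hnq σ h1 h2) x _ rfl hx M hM

/-- Wiring check: the registered stubs feed `DegreeOnePrimesEscape_of` as stated. -/
example : Summit.QuantumAdvantage.QuantumAdvantage.Theses.LinnikCubicClassGroups.DegreeOnePrimesEscape :=
  DegreeOnePrimesEscape_of stub_logFreeDensityCG stub_logFreeDensityZ1 stub_residueFromStark
    stub_perCharacterDeficit_of_density stub_lowerPIT_of_density stub_starkNoQuadSubfield

/-- **The v3 composition** (A-free forms; this is what the TZ fact feeds, §5): `PerCharacterDeficit →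
LowerPITUnlessNearbyZero → StarkNoQuadSubfieldInexplicit → DegreeOnePrimesEscape`, as a named `Prop`
(so that `DegreeOnePrimesEscape_of` stays the ONLY theorem of this file concluding the crux by name —
the skeleton audit takes the first such theorem as the skeleton). -/
def CruxFromV3 : Prop := PerCharacterDeficit → LowerPITUnlessNearbyZero → StarkNoQuadSubfieldInexplicit →
  Summit.QuantumAdvantage.QuantumAdvantage.Theses.LinnikCubicClassGroups.DegreeOnePrimesEscape

/-- The v3 composition holds (via `escape_of_inputs`). -/
theorem cruxFromV3_holds : CruxFromV3 := by
  intro hD hL hS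
  classical
  intro n
  rcases Nat.lt_or_ge n 3 with hn3 | hn3
  · refine ⟨0, ?_⟩
    intro K _ _ hKn hnq x hx M hM
    exact (degenerate_false hn3 K hKn hnq M hM).elim
  · have h1n : 1 < n := by omega
    obtain ⟨C₂, hC₂⟩ := hD n h1n
    obtain ⟨C₁, hC₁⟩ := hL n h1n
    obtain ⟨c, hc, hSc⟩ := hS n
    refine ⟨(⌈max (max C₂ C₁) (max 1 (4 / c))⌉₊ + 50) * (1 + n ^ 2) + n, ?_⟩
    intro K _ _ hKn hnq x hx M hM
    exact escape_of_inputs hn3 hc K hKn (fun χ hχ y hy => hC₂ K hKn χ hχ y hy)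
      (fun y hy => hC₁ K hKn y hy) (fun σ h1 h2 => hSc K hKn hnq σ h1 h2) x _ rfl hx M hM

/-- **The crux from the κ-forms plus the residue bound** (what T4, T5, R, S feed), as a named `Prop`. -/
def CruxFromκ : Prop := ResidueLowerBound → PerCharacterDeficitκ → LowerPITκ → StarkNoQuadSubfieldInexplicit →
  Summit.QuantumAdvantage.QuantumAdvantage.Theses.LinnikCubicClassGroups.DegreeOnePrimesEscape

/-- `CruxFromκ` holds (same composition as `DegreeOnePrimesEscape_of`, the density stubs being used only
through T4/T5). -/
theorem cruxFromκ_holds : CruxFromκ := by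
  intro hRes hD hL hS
  classical
  intro n
  rcases Nat.lt_or_ge n 3 with hn3 | hn3
  · refine ⟨0, ?_⟩
    intro K _ _ hKn hnq x hx M hM
    exact (degenerate_false hn3 K hKn hnq M hM).elim
  · have h1n : 1 < n := by omega
    obtain ⟨A, hA0, hRes⟩ := hRes n
    obtain ⟨C₂, hC₂⟩ := hD n h1n A hA0
    obtain ⟨C₁, hC₁⟩ := hL n h1n A hA0
    obtain ⟨c, hc, hSc⟩ := hS n
    refine ⟨(⌈max (max C₂ C₁) (max 1 (4 / c))⌉₊ + 50) * (1 + n ^ 2) + n, ?_⟩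
    intro K _ _ hKn hnq x hx M hM
    have hκ := hRes K hKn hnq
    exact escape_of_inputs hn3 hc K hKn (fun χ hχ y hy => hC₂ K hKn hκ χ hχ y hy)
      (fun y hy => hC₁ K hKn hκ y hy) (fun σ h1 h2 => hSc K hKn hnq σ h1 h2) x _ rfl hx M hM


/-! ## §5 The stubs are consequences of the vendored facts (no costume, no junk; a second, independent
conditional proof of the crux through this skeleton)

STUB 3 ⇐ `Stark1974_dedekindZeta_ne_zero_of_noQuadraticSubfield` (`starkNoQuadSubfield_of_named`, §1);
STUB 2 ⇐ `ThornerZaman2019_classPNT_hilbertClassField` (`lowerPITUnlessNearbyZero_of_TZ`);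
STUB 1 ⇐ `ThornerZaman2019_classPNT_hilbertClassField` (`perCharacterDeficit_of_TZ`) — all PROVED below,
so `cruxFromTZStark_holds : TZ → Stark → DegreeOnePrimesEscape` through `DegreeOnePrimesEscape_of`.
The first four helpers are copied (attributed) from `IdeatorSketchR1I3.lean` §OneSidedShadows. -/

/-! ### Helpers copied from `IdeatorSketchR1I3.lean` (OneSidedShadows; ideator r1/i3) -/



/-- `log Q ≥ n log 2` for `Q = |d_K| n^n`, `n = [K:ℚ] ≥ 2`. [folklore] -/
theorem finrank_mul_log_two_le_log_condQn (K : Type) [Field K] [NumberField K]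
    (hK : 1 < Module.finrank ℚ K) :
    (Module.finrank ℚ K : ℝ) * Real.log 2 ≤ Real.log (ThornerZaman.condQn K) := by
  have hn : (2 : ℝ) ≤ Module.finrank ℚ K := by exact_mod_cast hK
  have hd : (1 : ℝ) ≤ |(NumberField.discr K : ℝ)| := by
    rw [← Int.cast_abs]; exact_mod_cast Int.one_le_abs (NumberField.discr_ne_zero K)
  have hnpos : (0 : ℝ) < Module.finrank ℚ K := by linarith
  unfold ThornerZaman.condQn
  rw [Real.log_mul (by linarith) (by positivity), Real.log_pow]
  have h1 : 0 ≤ Real.log |(NumberField.discr K : ℝ)| := Real.log_nonneg hd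
  have h2 : Real.log 2 ≤ Real.log (Module.finrank ℚ K : ℝ) := Real.log_le_log (by norm_num) hn
  nlinarith

/-- The uniform error bound: with `L = max 1 (log (64 c₃))` and
`C₀ ≥ max (L/c₂) (L²/(c₂ log 2))`, for every `K` of degree `> 1` and `x ≥ Q^{C₀}`:
`c₃ · E(x) ≤ 1/32`. [folklore] -/
theorem errorTermN_le_of_ge {c₂ c₃ C₀ : ℝ} (hc₂ : 0 < c₂) (hc₃ : 0 < c₃)
    (hC₁ : max 1 (Real.log (64 * c₃)) / c₂ ≤ C₀)
    (hC₂ : (max 1 (Real.log (64 * c₃))) ^ 2 / (c₂ * Real.log 2) ≤ C₀)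
    (K : Type) [Field K] [NumberField K] (hK : 1 < Module.finrank ℚ K)
    {x : ℝ} (hx : ThornerZaman.condQn K ^ C₀ ≤ x) :
    c₃ * ThornerZaman.errorTermN c₂ (ThornerZaman.condQn K) (Module.finrank ℚ K) x ≤ 1 / 32 := by
  set L : ℝ := max 1 (Real.log (64 * c₃)) with hLdef
  set Q : ℝ := ThornerZaman.condQn K with hQdef
  set n : ℕ := Module.finrank ℚ K with hndef
  have hL1 : 1 ≤ L := le_max_left _ _
  have hL0 : 0 < L := by linarith
  have hQ12 : 12 ≤ Q := ThornerZaman.twelve_le_condQn (K := K) hK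
  have hQpos : 0 < Q := by linarith
  have hlogQ : 0 < Real.log Q := Real.log_pos (by linarith)
  have hC₀pos : 0 < C₀ := lt_of_lt_of_le (by positivity) hC₁
  have hxpos : 0 < x := lt_of_lt_of_le (Real.rpow_pos_of_pos hQpos _) hx
  have hlogx : C₀ * Real.log Q ≤ Real.log x := by
    have := Real.log_le_log (Real.rpow_pos_of_pos hQpos _) hx
    rwa [Real.log_rpow hQpos] at this
  have hlog2 : (0 : ℝ) < Real.log 2 := Real.log_pos (by norm_num)
  -- term 1
  have hT1 : Real.exp (-(c₂ * Real.log x / Real.log Q)) ≤ Real.exp (-L) := by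
    apply Real.exp_le_exp.mpr
    have h1 : L ≤ c₂ * C₀ := by
      have := (div_le_iff₀ hc₂).1 hC₁; linarith
    have h2 : c₂ * C₀ ≤ c₂ * Real.log x / Real.log Q := by
      rw [le_div_iff₀ hlogQ]; nlinarith
    linarith
  -- term 2
  have hnlog : (n : ℝ) * Real.log 2 ≤ Real.log Q := finrank_mul_log_two_le_log_condQn K hK
  have h2n : (2 : ℝ) ≤ n := by exact_mod_cast hK
  have hn0 : (0 : ℝ) < n := by linarith
  have hT2 : Real.exp (-(Real.sqrt (c₂ * Real.log x) / Real.sqrt n)) ≤ Real.exp (-L) := by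
    apply Real.exp_le_exp.mpr
    have hsq : L ^ 2 ≤ c₂ * Real.log x / n := by
      rw [le_div_iff₀ hn0]
      have h1 : L ^ 2 ≤ C₀ * (c₂ * Real.log 2) := by
        have := (div_le_iff₀ (by positivity)).1 hC₂; linarith
      have h2 : C₀ * (c₂ * Real.log 2) * n ≤ c₂ * (C₀ * Real.log Q) := by nlinarith
      nlinarith
    have hge : L ≤ Real.sqrt (c₂ * Real.log x) / Real.sqrt n := by
      rw [← Real.sqrt_div' _ hn0.le]  -- √a / √n = √(a/n)? check orientation
      calc L = Real.sqrt (L ^ 2) := by rw [Real.sqrt_sq hL0.le]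
        _ ≤ Real.sqrt (c₂ * Real.log x / n) := Real.sqrt_le_sqrt hsq
    linarith
  have hexpL : Real.exp (-L) ≤ 1 / (64 * c₃) := by
    have : Real.log (64 * c₃) ≤ L := le_max_right _ _
    calc Real.exp (-L) ≤ Real.exp (-Real.log (64 * c₃)) := Real.exp_le_exp.mpr (by linarith)
      _ = 1 / (64 * c₃) := by rw [Real.exp_neg, Real.exp_log (by positivity), one_div]
  unfold ThornerZaman.errorTermN
  have hsum : Real.exp (-(c₂ * Real.log x / Real.log Q)) +
      Real.exp (-(Real.sqrt (c₂ * Real.log x) / Real.sqrt n)) ≤ 2 * (1 / (64 * c₃)) := by linarith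
  calc c₃ * (Real.exp (-(c₂ * Real.log x / Real.log Q)) +
        Real.exp (-(Real.sqrt (c₂ * Real.log x) / Real.sqrt ↑n)))
      ≤ c₃ * (2 * (1 / (64 * c₃))) := by gcongr
    _ = 1 / 32 := by field_simp; ring
/-- **An explicit upper bound for `Li`**: `Li(x) ≤ (26/25) · x/log x` once `log x ≥ 60`
(integration by parts `Li = x/log x − 2/log 2 + Li₂`, and `Li₂(x) ≤ Li₂(√x) + 2 Li(x)/log x`,
`Li₂(√x) ≤ (√x − 2)/log² 2`, all from the tree's `LogIntegralProofs`). [folklore] -/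
theorem offsetLogIntegral_le_mul_div_log {x : ℝ} (hx : Real.exp 60 ≤ x) :
    offsetLogIntegral x ≤ 26 / 25 * (x / Real.log x) := by
  have he : (1 : ℝ) ≤ Real.exp 60 := Real.one_le_exp (by norm_num)
  have hx1 : (1 : ℝ) < x := by
    have : (1:ℝ) < Real.exp 60 := by
      have := Real.add_one_le_exp (60:ℝ); linarith
    linarith
  have hx0 : 0 < x := by linarith
  have hlogx : 60 ≤ Real.log x := (Real.le_log_iff_exp_le hx0).2 hx
  have hlogpos : 0 < Real.log x := by linarith
  -- √x
  have hsqrt_sq : Real.sqrt x ^ 2 = x := Real.sq_sqrt hx0.le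
  have hsqrt1 : (1 : ℝ) < Real.sqrt x := by
    rw [show (1:ℝ) = Real.sqrt 1 by simp]; exact Real.sqrt_lt_sqrt (by norm_num) hx1
  have hlog_sqrt : Real.log (Real.sqrt x) = Real.log x / 2 := by
    rw [Real.log_sqrt hx0.le]
  -- e^{30} ≤ √x, hence 3000 · √x ≤ x / log x is not needed in this crude form; we use √x · 200 ≤ x/ log x
  have hsqrt_ge : Real.exp 30 ≤ Real.sqrt x := by
    rw [show Real.exp 30 = Real.sqrt (Real.exp 60) by
      rw [show (60:ℝ) = 30 + 30 by norm_num, Real.exp_add, Real.sqrt_mul_self (Real.exp_pos _).le]]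
    exact Real.sqrt_le_sqrt hx
  have h2sqrt : (2 : ℝ) ≤ Real.sqrt x := by
    have : (2:ℝ) ≤ Real.exp 30 := by have := Real.add_one_le_exp (30:ℝ); linarith
    linarith
  have hsqrt_le : Real.sqrt x ≤ x := by nlinarith
  -- (1) integration by parts
  have hparts := offsetLogIntegralPow_integration_by_parts 1 hx1
  rw [offsetLogIntegralPow_one] at hparts
  simp only [pow_one, Nat.cast_one, one_mul] at hparts
  -- (2) Li₂ x ≤ Li₂ √x + (log √x)⁻¹ Li x
  have hsucc := offsetLogIntegralPow_succ_le 1 h2sqrt hsqrt_le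
  rw [offsetLogIntegralPow_one, hlog_sqrt] at hsucc
  -- (3) Li₂ √x ≤ (log 2)⁻¹ Li₁ √x ≤ (log 2)⁻² (√x − 2)
  have hA := offsetLogIntegralPow_succ_le 1 (le_refl (2:ℝ)) h2sqrt
  have hB := offsetLogIntegralPow_succ_le 0 (le_refl (2:ℝ)) h2sqrt
  simp only [offsetLogIntegralPow_two, zero_add] at hA hB
  rw [offsetLogIntegralPow_zero] at hB
  rw [offsetLogIntegralPow_one] at hA hB
  have hlog2 : (0.6931471803 : ℝ) < Real.log 2 := Real.log_two_gt_d9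
  have hl2pos : 0 < Real.log 2 := by linarith
  have hinv2 : (Real.log 2)⁻¹ ≤ 3 / 2 := by
    rw [inv_le_comm₀ hl2pos (by norm_num)]; linarith
  have hLi_sqrt_nonneg : 0 ≤ offsetLogIntegral (Real.sqrt x) := by
    have := sub_mul_inv_log_pow_le_offsetLogIntegralPow 1 h2sqrt
    rw [offsetLogIntegralPow_one] at this
    have h0 : 0 ≤ (Real.sqrt x - 2) * (Real.log (Real.sqrt x))⁻¹ ^ 1 := by
      apply mul_nonneg (by linarith)
      apply pow_nonneg; apply inv_nonneg.2; apply Real.log_nonneg hsqrt1.le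
    linarith
  -- Li₂ √x ≤ (3/2) Li √x ≤ (3/2)(3/2)(√x − 2) ≤ (9/4) √x
  have hLi2sqrt : offsetLogIntegralPow 2 (Real.sqrt x) ≤ 9 / 4 * Real.sqrt x := by
    have h1 : offsetLogIntegralPow 2 (Real.sqrt x) ≤ 3 / 2 * offsetLogIntegral (Real.sqrt x) := by
      calc offsetLogIntegralPow 2 (Real.sqrt x) ≤ (Real.log 2)⁻¹ * offsetLogIntegral (Real.sqrt x) := hA
        _ ≤ 3 / 2 * offsetLogIntegral (Real.sqrt x) := by gcongr
    have h2 : offsetLogIntegral (Real.sqrt x) ≤ 3 / 2 * (Real.sqrt x - 2) := by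
      calc offsetLogIntegral (Real.sqrt x) ≤ (Real.log 2)⁻¹ * (Real.sqrt x - 2) := hB
        _ ≤ 3 / 2 * (Real.sqrt x - 2) := by gcongr
    nlinarith
  -- combine: Li x = x/log x − 2/log 2 + Li₂ x ≤ x/log x + 9/4 √x + (2/log x) Li x
  have hLi2x : offsetLogIntegralPow 2 x ≤ 9 / 4 * Real.sqrt x + (2 / Real.log x) * offsetLogIntegral x := by
    have : (Real.log x / 2)⁻¹ = 2 / Real.log x := by rw [inv_div]
    rw [this] at hsucc
    linarith
  have hmain : offsetLogIntegral x * (1 - 2 / Real.log x) ≤ x / Real.log x + 9 / 4 * Real.sqrt x := by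
    have h2l : 0 ≤ 2 * (Real.log 2)⁻¹ := by positivity
    have : offsetLogIntegral x ≤ x * (Real.log x)⁻¹ + offsetLogIntegralPow 2 x := by linarith
    rw [← div_eq_mul_inv] at this
    nlinarith
  -- 9/4 √x ≤ (1/1000) x / log x, via u = x^{1/4} ≥ e^{15} ≥ 9000 and log x ≤ 4u
  have hsmall : 9 / 4 * Real.sqrt x ≤ 1 / 1000 * (x / Real.log x) := by
    have hsx0 : 0 ≤ Real.sqrt x := by linarith
    set u : ℝ := (Real.sqrt x) ^ ((1:ℝ)/2) with hu
    have hu2 : u * u = Real.sqrt x := by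
      rw [hu, ← Real.rpow_add (by linarith)]; norm_num
    have hu_ge : Real.exp 15 ≤ u := by
      have : Real.exp 15 = (Real.exp 30) ^ ((1:ℝ)/2) := by
        rw [← Real.exp_mul]; norm_num
      rw [this, hu]
      exact Real.rpow_le_rpow (Real.exp_pos _).le hsqrt_ge (by norm_num)
    have he15 : (9000 : ℝ) ≤ Real.exp 15 := by
      have h1 : Real.exp 15 = Real.exp 1 ^ 15 := by
        rw [← Real.exp_nat_mul]; norm_num
      have h2 : (2.7 : ℝ) ≤ Real.exp 1 := le_of_lt (lt_trans (by norm_num) Real.exp_one_gt_d9)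
      rw [h1]
      calc (9000 : ℝ) ≤ 2.7 ^ 15 := by norm_num
        _ ≤ Real.exp 1 ^ 15 := pow_le_pow_left₀ (by norm_num) h2 15
    have hu9000 : (9000 : ℝ) ≤ u := le_trans he15 hu_ge
    have hupos : 0 < u := by linarith
    have hl : Real.log (Real.sqrt x) ≤ (Real.sqrt x) ^ ((1:ℝ)/2) / ((1:ℝ)/2) :=
      Real.log_le_rpow_div hsx0 (by norm_num)
    have hlogx_le : Real.log x ≤ 4 * u := by
      have h1 : Real.log x = 2 * Real.log (Real.sqrt x) := by rw [hlog_sqrt]; ring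
      have h2 : Real.log (Real.sqrt x) ≤ 2 * u := by
        calc Real.log (Real.sqrt x) ≤ u / ((1:ℝ)/2) := hl
          _ = 2 * u := by ring
      linarith
    have hx_u : x = (u * u) * (u * u) := by
      calc x = Real.sqrt x ^ 2 := hsqrt_sq.symm
        _ = (u * u) * (u * u) := by rw [← hu2]; ring
    have hdiv : x / (4 * u) ≤ x / Real.log x :=
      div_le_div_of_nonneg_left hx0.le hlogpos hlogx_le
    have hkey : 9 / 4 * Real.sqrt x ≤ 1 / 1000 * (x / (4 * u)) := by
      rw [← hu2, hx_u]
      have : 1 / 1000 * ((u * u) * (u * u) / (4 * u)) = u ^ 3 / 4000 := by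
        field_simp; ring
      rw [this]
      nlinarith [hu9000, hupos]
    calc 9 / 4 * Real.sqrt x ≤ 1 / 1000 * (x / (4 * u)) := hkey
      _ ≤ 1 / 1000 * (x / Real.log x) := by gcongr
  -- finish: Li x (1 − 2/log x) ≤ (1 + 1/1000) x/log x and 1 − 2/log x ≥ 29/30
  have hfac : (29:ℝ)/30 ≤ 1 - 2 / Real.log x := by
    have : 2 / Real.log x ≤ 1 / 30 := by
      rw [div_le_iff₀ hlogpos]; linarith
    linarith
  have hxl : 0 ≤ x / Real.log x := by positivity
  by_cases hLi : offsetLogIntegral x ≤ 0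
  · linarith
  · rw [not_le] at hLi
    have h1 : offsetLogIntegral x * (29 / 30) ≤ 1001 / 1000 * (x / Real.log x) := by
      calc offsetLogIntegral x * (29 / 30) ≤ offsetLogIntegral x * (1 - 2 / Real.log x) := by
            gcongr
        _ ≤ x / Real.log x + 9 / 4 * Real.sqrt x := hmain
        _ ≤ 1001 / 1000 * (x / Real.log x) := by linarith
    linarith

open Classical in
/-- The class map on ideals (junk value `1` at the zero ideal). [folklore] -/
noncomputable def classOf (K : Type) [Field K] [NumberField K] (P : Ideal (𝓞 K)) :
    ClassGroup (𝓞 K) :=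
  if hP : P ∈ (Ideal (𝓞 K))⁰ then ClassGroup.mk0 ⟨P, hP⟩ else 1

theorem classOf_eq {K : Type} [Field K] [NumberField K] {P : Ideal (𝓞 K)}
    (hP : P ∈ (Ideal (𝓞 K))⁰) : classOf K P = ClassGroup.mk0 ⟨P, hP⟩ := by
  rw [classOf, dif_pos hP]

open Classical in
/-- **Fibrewise count**: the primes of norm `≤ x` whose class lies in a finset `T` of classes are
counted class by class by the tree's `primeIdealClassCount`. [folklore] -/
theorem ncard_primes_class_mem_eq_sum (K : Type) [Field K] [NumberField K] (x : ℝ)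
    (T : Finset (ClassGroup (𝓞 K))) :
    Set.ncard {P : Ideal (𝓞 K) | P.IsPrime ∧ (Ideal.absNorm P : ℝ) ≤ x ∧
        ∃ hP : P ∈ (Ideal (𝓞 K))⁰, ClassGroup.mk0 ⟨P, hP⟩ ∈ T}
      = ∑ C ∈ T, primeIdealClassCount K C x := by
  set S : Set (Ideal (𝓞 K)) := {P : Ideal (𝓞 K) | P.IsPrime ∧ (Ideal.absNorm P : ℝ) ≤ x ∧
        ∃ hP : P ∈ (Ideal (𝓞 K))⁰, ClassGroup.mk0 ⟨P, hP⟩ ∈ T} with hSdef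
  have hSfin : S.Finite := by
    refine (finite_primeIdealsLE K x).subset ?_
    rintro P ⟨h1, h2, hP, -⟩
    exact ⟨h1, nonZeroDivisors.ne_zero hP, h2⟩
  rw [Set.ncard_eq_toFinset_card S hSfin]
  rw [Finset.card_eq_sum_card_fiberwise (f := classOf K) (t := T) ?_]
  · apply Finset.sum_congr rfl
    intro C hC
    rw [primeIdealClassCount, ← Set.ncard_coe_finset]
    congr 1
    ext P
    simp only [Finset.coe_filter, Set.Finite.mem_toFinset, Set.mem_setOf_eq, primeIdealsInClassLE,
      hSdef]
    constructor
    · rintro ⟨⟨h1, h2, hP, hT⟩, hc⟩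
      refine ⟨h1, h2, hP, ?_⟩
      rw [← classOf_eq hP]; exact hc
    · rintro ⟨h1, h2, hP, hc⟩
      refine ⟨⟨h1, h2, hP, ?_⟩, ?_⟩
      · rw [hc]; exact hC
      · rw [classOf_eq hP]; exact hc
  · intro P hPS
    rw [Finset.mem_coe, Set.Finite.mem_toFinset] at hPS
    obtain ⟨-, -, hP, hT⟩ := hPS
    rw [Finset.mem_coe, classOf_eq hP]; exact hT
open Classical in
/-- `π_K(x) = ∑_C π_C(x)`. [folklore] -/
theorem primeIdealCount_eq_sum_classCount (K : Type) [Field K] [NumberField K] (x : ℝ) :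
    primeIdealCount K x = ∑ C : ClassGroup (𝓞 K), primeIdealClassCount K C x := by
  rw [← ncard_primes_class_mem_eq_sum K x Finset.univ, primeIdealCount]
  congr 1
  ext P
  simp only [primeIdealsLE, Set.mem_setOf_eq, Finset.mem_univ, exists_prop, and_true]
  constructor
  · rintro ⟨h1, h2, h3⟩
    exact ⟨h1, h3, mem_nonZeroDivisors_of_ne_zero h2⟩
  · rintro ⟨h1, h2, h3⟩
    exact ⟨h1, nonZeroDivisors.ne_zero h3, h2⟩



/-! ### new helpers -/

/-- Values of a character of a finite group have norm one. [folklore] -/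
theorem char_norm_eq_one {G : Type*} [Group G] [Fintype G] (χ : G →* ℂˣ) (g : G) :
    ‖((χ g : ℂˣ) : ℂ)‖ = 1 := by
  have h1 : (χ g) ^ Fintype.card G = 1 := by rw [← map_pow, pow_card_eq_one, map_one]
  have h2 : ((χ g : ℂˣ) : ℂ) ^ Fintype.card G = 1 := by
    rw [← Units.val_pow_eq_pow_val, h1, Units.val_one]
  exact Complex.norm_eq_one_of_pow_eq_one h2 Fintype.card_ne_zero

/-- Hence `|Re χ(g)| ≤ 1`. [folklore] -/
theorem char_abs_re_le_one {G : Type*} [Group G] [Fintype G] (χ : G →* ℂˣ) (g : G) :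
    |((χ g : ℂˣ) : ℂ).re| ≤ 1 := by
  have := Complex.abs_re_le_norm ((χ g : ℂˣ) : ℂ)
  rw [char_norm_eq_one] at this
  exact this

/-- `∑_g Re χ(g) ≥ 0` (it is `|G|` or `0`). [folklore] -/
theorem sum_re_char_nonneg {G : Type*} [CommGroup G] [Fintype G] (χ : G →* ℂˣ) :
    0 ≤ ∑ g : G, ((χ g : ℂˣ) : ℂ).re := by
  by_cases hχ : χ = 1
  · subst hχ; simp
  · have hψ : (Units.coeHom ℂ).comp χ ≠ 1 := by
      intro heq
      apply hχ
      ext g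
      have := DFunLike.congr_fun heq g
      simpa using this
    have h0 := sum_hom_units_eq_zero ((Units.coeHom ℂ).comp χ) hψ
    rw [← Complex.re_sum]
    have : ∑ g : G, ((χ g : ℂˣ) : ℂ) = ∑ g : G, ((Units.coeHom ℂ).comp χ) g := by
      apply Finset.sum_congr rfl; intro g _; rfl
    rw [this, h0, Complex.zero_re]

/-- `∑_g Re χ(g) = 0` for `χ ≠ 1`. [folklore] -/
theorem sum_re_char_eq_zero {G : Type*} [CommGroup G] [Fintype G] (χ : G →* ℂˣ) (hχ : χ ≠ 1) :
    ∑ g : G, ((χ g : ℂˣ) : ℂ).re = 0 := by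
  have hψ : (Units.coeHom ℂ).comp χ ≠ 1 := by
    intro heq
    apply hχ
    ext g
    have := DFunLike.congr_fun heq g
    simpa using this
  have h0 := sum_hom_units_eq_zero ((Units.coeHom ℂ).comp χ) hψ
  rw [← Complex.re_sum]
  have : ∑ g : G, ((χ g : ℂˣ) : ℂ) = ∑ g : G, ((Units.coeHom ℂ).comp χ) g := by
    apply Finset.sum_congr rfl; intro g _; rfl
  rw [this, h0, Complex.zero_re]

/-- A real character (`χ₁² = 1`) has real values, so `Re χ(g) · Re χ₁(g) = Re (χχ₁)(g)`. [folklore] -/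
theorem re_mul_re_of_real {G : Type*} [CommGroup G] (χ χ₁ : G →* ℂˣ) (hreal : χ₁ * χ₁ = 1) (g : G) :
    ((χ g : ℂˣ) : ℂ).re * ((χ₁ g : ℂˣ) : ℂ).re = (((χ * χ₁) g : ℂˣ) : ℂ).re := by
  have h1 : χ₁ g * χ₁ g = 1 := by rw [← MonoidHom.mul_apply, hreal, MonoidHom.one_apply]
  have h2 : ((χ₁ g : ℂˣ) : ℂ) * ((χ₁ g : ℂˣ) : ℂ) = 1 := by
    rw [← Units.val_mul, h1, Units.val_one]
  have him : ((χ₁ g : ℂˣ) : ℂ).im = 0 := by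
    rcases mul_self_eq_one_iff.mp h2 with h | h <;> rw [h] <;> simp
  rw [MonoidHom.mul_apply, Units.val_mul, Complex.mul_re, him, mul_zero, sub_zero]

/-- `(100(n+1))⁴ ≤ 12^{4n+8}`. [folklore] -/
theorem pow_bound12 (n : ℕ) : (100 * (n + 1)) ^ 4 ≤ 12 ^ (4 * n + 8) := by
  have h1 : n + 1 ≤ 12 ^ n := by
    have := Nat.lt_pow_self (show 1 < 12 by norm_num) (n := n)
    omega
  have h2 : 100 * (n + 1) ≤ 12 ^ (n + 2) := by
    rw [pow_add]; nlinarith [show (100:ℕ) ≤ 12 ^ 2 by norm_num]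
  calc (100 * (n + 1)) ^ 4 ≤ (12 ^ (n + 2)) ^ 4 := Nat.pow_le_pow_left h2 4
    _ = 12 ^ (4 * n + 8) := by rw [← pow_mul]; ring_nf

/-- For `x ≥ 0` the real cut-off `N P ≤ x` only sees `⌊x⌋₊`. [folklore] -/
theorem degOneClassCount_floor (K : Type) [Field K] [NumberField K] (C : ClassGroup (𝓞 K)) {x : ℝ}
    (hx : 0 ≤ x) : degOneClassCount K C x = degOneClassCount K C (⌊x⌋₊ : ℝ) := by
  unfold degOneClassCount
  congr 1
  ext P
  simp only [Set.mem_setOf_eq, Nat.cast_le]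
  rw [← Nat.le_floor_iff hx]

theorem primeIdealCount_floor (K : Type) [Field K] [NumberField K] {x : ℝ} (hx : 0 ≤ x) :
    primeIdealCount K x = primeIdealCount K (⌊x⌋₊ : ℝ) := by
  unfold primeIdealCount primeIdealsLE
  congr 1
  ext P
  simp only [Set.mem_setOf_eq, Nat.cast_le]
  rw [← Nat.le_floor_iff hx]

/-- Degree-one primes in a class are among all primes in the class. [folklore] -/
theorem degOneClassCount_le (K : Type) [Field K] [NumberField K] (C : ClassGroup (𝓞 K)) (x : ℝ) :
    degOneClassCount K C x ≤ primeIdealClassCount K C x := by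
  unfold degOneClassCount primeIdealClassCount
  refine Set.ncard_le_ncard ?_ (finite_primeIdealsInClassLE C x)
  rintro P ⟨h1, h2, hP, h3⟩
  exact ⟨Ideal.isPrime_of_irreducible_absNorm h1, h2, hP, h3⟩

/-- **Degree ≥ 2 primes are few, class by class in total**:
`π_K(x) ≤ ∑_C #(deg-1 primes ≤ x in C) + [K:ℚ]·(√x + 1)`. [folklore] -/
theorem primeIdealCount_le_sum_degOneClassCount_add (K : Type) [Field K] [NumberField K] {x : ℝ}
    (hx : 0 ≤ x) :
    (primeIdealCount K x : ℝ) ≤ ∑ C : ClassGroup (𝓞 K), (degOneClassCount K C x : ℝ) +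
      (Module.finrank ℚ K : ℝ) * (Real.sqrt x + 1) := by
  classical
  set N : ℕ := ⌊x⌋₊ with hN
  have h1 : primeIdealCount K x = primeIdealCount K (N : ℝ) := primeIdealCount_floor K hx
  have h2 := primeIdealCount_le_degOne_add K N
  have h3 : Set.ncard {P : Ideal (𝓞 K) | P.IsPrime ∧ P ≠ ⊥ ∧ (Ideal.absNorm P).Prime ∧ Ideal.absNorm P ≤ N}
      = ∑ p ∈ (Finset.Icc 0 N).filter Nat.Prime, normPrimeIdealCount K p := ncard_degOne_eq_sum K N
  have h4 := ncard_degOne_eq_sum_classes K N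
  have h5 : ∀ C : ClassGroup (𝓞 K), degOneClassCount K C x = (degOneInClass K N C).ncard := by
    intro C
    rw [degOneClassCount_floor K C hx, ← hN, degOneClassCount_natCast K N C]
  have hsum : (∑ C : ClassGroup (𝓞 K), (degOneClassCount K C x : ℝ)) =
      ((Set.ncard {P : Ideal (𝓞 K) | P.IsPrime ∧ P ≠ ⊥ ∧ (Ideal.absNorm P).Prime ∧ Ideal.absNorm P ≤ N} : ℕ) : ℝ) := by
    rw [h4]; push_cast
    exact Finset.sum_congr rfl fun C _ => by rw [h5 C]
  -- π(√N) ≤ √N + 1 ≤ √x + 1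
  have hpisqrt : (Nat.primeCounting (Nat.sqrt N) : ℝ) ≤ Real.sqrt x + 1 := by
    have ha : Nat.primeCounting (Nat.sqrt N) ≤ Nat.sqrt N + 1 := by
      rw [Nat.primeCounting, Nat.primeCounting']
      exact Nat.count_le _
    have hb : ((Nat.sqrt N : ℕ) : ℝ) ≤ Real.sqrt (N : ℝ) := by
      rw [Real.le_sqrt (by positivity) (by positivity)]
      exact_mod_cast Nat.sqrt_le' N
    have hc : Real.sqrt (N : ℝ) ≤ Real.sqrt x := Real.sqrt_le_sqrt (Nat.floor_le hx)
    calc (Nat.primeCounting (Nat.sqrt N) : ℝ) ≤ (Nat.sqrt N : ℝ) + 1 := by exact_mod_cast ha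
      _ ≤ Real.sqrt x + 1 := by linarith
  have h2' : ((primeIdealCount K (N : ℝ) : ℕ) : ℝ) ≤
      ((Set.ncard {P : Ideal (𝓞 K) | P.IsPrime ∧ P ≠ ⊥ ∧ (Ideal.absNorm P).Prime ∧ Ideal.absNorm P ≤ N} : ℕ) : ℝ)
        + (Module.finrank ℚ K : ℝ) * (Nat.primeCounting (Nat.sqrt N) : ℝ) := by
    rw [h3]; exact_mod_cast h2
  have hn0 : (0 : ℝ) ≤ Module.finrank ℚ K := Nat.cast_nonneg _
  have h6 : (Module.finrank ℚ K : ℝ) * (Nat.primeCounting (Nat.sqrt N) : ℝ) ≤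
      (Module.finrank ℚ K : ℝ) * (Real.sqrt x + 1) := mul_le_mul_of_nonneg_left hpisqrt hn0
  rw [h1, hsum]
  linarith

/-! ### STUB 2 from Thorner–Zaman -/

/-- **`LowerPITUnlessNearbyZero` follows from the vendored Thorner–Zaman fact** (so STUB 2 is no
stronger than what the tree already cites): sum the class dichotomy over all classes; the `β₁`-terms cancel
unless `χ₁ = 1`; if `χ₁ = 1`, `β₁` is a real zero of `ζ_K = L(s,1)` in the window, and either
`(1 − β₁) log x < 4` (second alternative) or the depletion is `≤ e^{−4}` and `29 Li ≤ 32 π_K`.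
(Arithmetic verbatim from `HeilbronnCount.lowerPITShadow_of_TZ_starkInexplicit`.) -/
theorem lowerPITUnlessNearbyZero_of_TZ (hTZ : ThornerZaman2019_classPNT_hilbertClassField) :
    LowerPITUnlessNearbyZero := by
  classical
  obtain ⟨c₁, c₂, c₃, hc₁, hc₂, hc₃, H⟩ := hTZ
  intro n hn
  set L : ℝ := max 1 (Real.log (64 * c₃)) with hLdef
  refine ⟨max (max c₁ 44) (max (L / c₂) (L ^ 2 / (c₂ * Real.log 2))), ?_⟩
  intro K _ _ hKn x hx
  have hK : 1 < Module.finrank ℚ K := by rw [hKn]; exact hn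
  set C₁ : ℝ := max (max c₁ 44) (max (L / c₂) (L ^ 2 / (c₂ * Real.log 2))) with hC₁def
  set Q : ℝ := ThornerZaman.condQn K with hQdef
  set h : ℕ := NumberField.classNumber K with hhdef
  -- basic sizes
  have hQ12 : 12 ≤ Q := ThornerZaman.twelve_le_condQn (K := K) hK
  have hQ1 : 1 ≤ Q := by linarith
  have hQpos : 0 < Q := by linarith
  have hC₁c₁ : c₁ ≤ C₁ := le_trans (le_max_left _ _) (le_max_left _ _)
  have hC₁44 : 44 ≤ C₁ := le_trans (le_max_right _ _) (le_max_left _ _)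
  have hC₁0 : 0 ≤ C₁ := by linarith
  have hxc₁ : Q ^ c₁ ≤ x := le_trans (Real.rpow_le_rpow_of_exponent_le hQ1 hC₁c₁) hx
  have hxpos : 0 < x := lt_of_lt_of_le (Real.rpow_pos_of_pos hQpos _) hx
  have hlogx : C₁ * Real.log Q ≤ Real.log x := by
    have := Real.log_le_log (Real.rpow_pos_of_pos hQpos _) hx
    rwa [Real.log_rpow hQpos] at this
  have hlog2 : (0.6931471803 : ℝ) < Real.log 2 := Real.log_two_gt_d9
  have hlogQ2 : 2 * Real.log 2 ≤ Real.log Q := by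
    have h1 := finrank_mul_log_two_le_log_condQn K hK
    have h2 : (2 : ℝ) ≤ Module.finrank ℚ K := by exact_mod_cast hK
    nlinarith
  have hlogQpos : 0 < Real.log Q := by linarith
  have hlogx60 : 60 ≤ Real.log x := by nlinarith
  have hx_exp : Real.exp 60 ≤ x := (Real.le_log_iff_exp_le hxpos).1 hlogx60
  have hx1 : 1 < x := by
    have : (1:ℝ) < Real.exp 60 := by have := Real.add_one_le_exp (60:ℝ); linarith
    linarith
  have hlogxpos : 0 < Real.log x := by linarith
  have hE : c₃ * ThornerZaman.errorTermN c₂ Q (Module.finrank ℚ K) x ≤ 1 / 32 :=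
    errorTermN_le_of_ge hc₂ hc₃
      (le_trans (le_max_left _ _) (le_max_right _ _))
      (le_trans (le_max_right _ _) (le_max_right _ _)) K hK hx
  have hEpos : 0 < c₃ * ThornerZaman.errorTermN c₂ Q (Module.finrank ℚ K) x :=
    mul_pos hc₃ (ThornerZaman.errorTermN_pos _ _ _ _)
  have hLiup : offsetLogIntegral x ≤ 26 / 25 * (x / Real.log x) :=
    offsetLogIntegral_le_mul_div_log hx_exp
  have hxl : 0 ≤ x / Real.log x := by positivity
  -- per-class lower bound
  have key : ∀ (π m : ℝ), |π - m| ≤ c₃ * ThornerZaman.errorTermN c₂ Q (Module.finrank ℚ K) x * m →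
      31 / 32 * m ≤ π := by
    intro π m hπ
    have hm : 0 ≤ m := by
      by_contra hneg
      rw [not_le] at hneg
      have : c₃ * ThornerZaman.errorTermN c₂ Q (Module.finrank ℚ K) x * m < 0 := mul_neg_of_pos_of_neg hEpos hneg
      linarith [abs_nonneg (π - m)]
    have h1 := (abs_sub_le_iff.1 hπ).2
    nlinarith
  -- total count
  have htot : (primeIdealCount K x : ℝ) = ∑ C : ClassGroup (𝓞 K), (primeIdealClassCount K C x : ℝ) := by
    exact_mod_cast primeIdealCount_eq_sum_classCount K x
  have hcardC : ((Finset.univ : Finset (ClassGroup (𝓞 K))).card : ℝ) = h := by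
    rw [Finset.card_univ, hhdef, NumberField.classNumber]
  have hhpos : (0 : ℝ) < h := by exact_mod_cast NumberField.classNumber_pos (K := K)
  have hx2 : (2:ℝ) ≤ x := by have := Real.add_one_le_exp (60:ℝ); linarith
  have hLix : 0 ≤ offsetLogIntegral x := by
    have := sub_mul_inv_log_pow_le_offsetLogIntegralPow 1 hx2
    rw [offsetLogIntegralPow_one] at this
    have h0 : 0 ≤ (x - 2) * (Real.log x)⁻¹ ^ 1 := by
      apply mul_nonneg (by linarith); positivity
    linarith
  rcases H K hK with ⟨-, hA⟩ | ⟨χ₁, β₁, -, hβlo, hβhi, hzero, hB⟩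
  · -- no exceptional zero: π_K ≥ (31/32) Li
    left
    have hC : ∀ C : ClassGroup (𝓞 K),
        31 / 32 * (offsetLogIntegral x / h) ≤ (primeIdealClassCount K C x : ℝ) :=
      fun C => key _ _ (hA C x hxc₁)
    have hπ : 31 / 32 * offsetLogIntegral x ≤ (primeIdealCount K x : ℝ) := by
      rw [htot]
      calc 31 / 32 * offsetLogIntegral x
          = ∑ C : ClassGroup (𝓞 K), 31 / 32 * (offsetLogIntegral x / h) := by
            rw [Finset.sum_const, nsmul_eq_mul, hcardC]; field_simp
        _ ≤ ∑ C : ClassGroup (𝓞 K), (primeIdealClassCount K C x : ℝ) :=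
            Finset.sum_le_sum fun C _ => hC C
    linarith only [hπ, hLix]
  · -- exceptional (χ₁, β₁)
    have hC : ∀ C : ClassGroup (𝓞 K), 31 / 32 *
        ((offsetLogIntegral x - ((χ₁ C : ℂ)).re * offsetLogIntegral (x ^ β₁)) / h)
          ≤ (primeIdealClassCount K C x : ℝ) :=
      fun C => key _ _ (hB C x hxc₁)
    have hsumπ : 31 / 32 * ∑ C : ClassGroup (𝓞 K),
        (offsetLogIntegral x - ((χ₁ C : ℂ)).re * offsetLogIntegral (x ^ β₁)) / h
          ≤ (primeIdealCount K x : ℝ) := by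
      rw [htot, Finset.mul_sum]
      exact Finset.sum_le_sum fun C _ => hC C
    have hsum : ∑ C : ClassGroup (𝓞 K),
        (offsetLogIntegral x - ((χ₁ C : ℂ)).re * offsetLogIntegral (x ^ β₁)) / (h : ℝ)
        = ((h : ℝ) * offsetLogIntegral x
            - (∑ C : ClassGroup (𝓞 K), ((χ₁ C : ℂ)).re) * offsetLogIntegral (x ^ β₁)) / h := by
      rw [← Finset.sum_div, Finset.sum_sub_distrib, Finset.sum_const, nsmul_eq_mul, Finset.sum_mul,
        hcardC]
    by_cases hχ1 : χ₁ = 1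
    · -- χ₁ trivial: β₁ is a zero of ζ_K
      subst hχ1
      have hre : ∑ C : ClassGroup (𝓞 K), (((1 : ClassGroup (𝓞 K) →* ℂˣ) C : ℂ)).re = h := by
        simp only [MonoidHom.one_apply, Units.val_one, Complex.one_re, Finset.sum_const,
          nsmul_eq_mul, mul_one]
        exact hcardC
      rw [hre] at hsum
      have hmain : ∑ C : ClassGroup (𝓞 K),
          (offsetLogIntegral x - (((1 : ClassGroup (𝓞 K) →* ℂˣ) C : ℂ)).re * offsetLogIntegral (x ^ β₁)) / (h : ℝ)
          = offsetLogIntegral x - offsetLogIntegral (x ^ β₁) := by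
        rw [hsum]; field_simp
      rw [hmain] at hsumπ
      have hβ1c : (β₁ : ℂ) ≠ 1 := by
        intro heq
        have := congrArg Complex.re heq
        simp at this
        linarith
      have hzeta : dedekindZetaCont K β₁ = 0 := by
        rw [← classGroupLFunction_one K hβ1c]; exact hzero
      by_cases hnear : (1 - β₁) * Real.log x < 4
      · right
        exact ⟨β₁, hβlo, hβhi, hzeta, hnear⟩
      · left
        have hgap : 4 ≤ (1 - β₁) * Real.log x := not_lt.mp hnear
        -- x^{β₁} ≤ x / 50
        have hβpos : 0 < β₁ := by
          have hlQ1 : 1 ≤ Real.log Q := by linarith only [hlogQ2, hlog2]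
          have : 1 / (8 * Real.log Q) ≤ 1 / 8 :=
            one_div_le_one_div_of_le (by norm_num) (by linarith only [hlQ1])
          linarith only [this, hβlo]
        have hxβ : x ^ β₁ ≤ x / 50 := by
          have h1 : x ^ β₁ = x ^ (β₁ - 1) * x := by
            rw [← Real.rpow_add_one hxpos.ne' (β₁ - 1)]; norm_num
          have h2 : x ^ (β₁ - 1) ≤ Real.exp (-4) := by
            rw [Real.rpow_def_of_pos hxpos]
            apply Real.exp_le_exp.2
            nlinarith only [hgap]
          have h3 : Real.exp (-4) ≤ 1 / 50 := by
            rw [Real.exp_neg]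
            have h50 : (50:ℝ) ≤ Real.exp 4 := by
              have e1 : Real.exp 4 = Real.exp 1 ^ 4 := by rw [← Real.exp_nat_mul]; norm_num
              have e2 : (2.7 : ℝ) ≤ Real.exp 1 := le_of_lt (lt_trans (by norm_num) Real.exp_one_gt_d9)
              rw [e1]
              calc (50:ℝ) ≤ 2.7 ^ 4 := by norm_num
                _ ≤ Real.exp 1 ^ 4 := pow_le_pow_left₀ (by norm_num) e2 4
            rw [inv_eq_one_div, div_le_div_iff₀ (Real.exp_pos 4) (by norm_num)]
            linarith
          rw [h1]
          have : x ^ (β₁ - 1) * x ≤ (1 / 50) * x := by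
            apply mul_le_mul_of_nonneg_right (le_trans h2 h3) hxpos.le
          linarith only [this]
        have hdiff : (x - x ^ β₁) / Real.log x ≤ offsetLogIntegral x - offsetLogIntegral (x ^ β₁) :=
          sub_rpow_div_log_le_offsetLogIntegral_sub hx1 hβpos hβhi.le
        have hdiff2 : 49 / 50 * (x / Real.log x) ≤ (x - x ^ β₁) / Real.log x := by
          rw [mul_div_assoc', div_le_div_iff_of_pos_right hlogxpos]
          linarith only [hxβ]
        linarith only [hsumπ, hdiff, hdiff2, hLiup, hxl]
    · -- χ₁ nontrivial: the β₁-terms cancel in the total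
      left
      have hre : ∑ C : ClassGroup (𝓞 K), ((χ₁ C : ℂ)).re = 0 := sum_re_char_eq_zero χ₁ hχ1
      rw [hre] at hsum
      have hmain : ∑ C : ClassGroup (𝓞 K),
          (offsetLogIntegral x - ((χ₁ C : ℂ)).re * offsetLogIntegral (x ^ β₁)) / (h : ℝ)
          = offsetLogIntegral x := by
        rw [hsum, zero_mul, sub_zero, mul_div_assoc, mul_div_cancel₀ _ hhpos.ne']
      rw [hmain] at hsumπ
      linarith only [hsumπ, hLix]

/-! ### STUB 1 from Thorner–Zaman -/

/-- Abstract step 1: replacing `a ≤ π` by `π` costs at most `∑ (π − a)` when `|re| ≤ 1`. [folklore] -/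
theorem sum_re_mul_le_add {ι : Type*} [Fintype ι] (re a π : ι → ℝ) (hre : ∀ i, |re i| ≤ 1)
    (haπ : ∀ i, a i ≤ π i) :
    ∑ i, re i * a i ≤ ∑ i, re i * π i + (∑ i, π i - ∑ i, a i) := by
  rw [← Finset.sum_sub_distrib, ← Finset.sum_add_distrib]
  refine Finset.sum_le_sum fun i _ => ?_
  have h1 := (abs_le.mp (hre i)).1
  have h2 := haπ i
  nlinarith

/-- Abstract step 2: `∑ re·π ≤ B/32` when `π` is within relative error `1/32` of a main term `m ≥ 0`
with `∑ m ≤ B` and the signed main sum `∑ re·m ≤ 0`. [folklore] -/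
theorem sum_re_mul_le_of_main {ι : Type*} [Fintype ι] (re π m : ι → ℝ) (B : ℝ)
    (hre : ∀ i, |re i| ≤ 1) (hm : ∀ i, |π i - m i| ≤ m i / 32) (hsum : ∑ i, m i ≤ B)
    (hsecond : ∑ i, re i * m i ≤ 0) : ∑ i, re i * π i ≤ B / 32 := by
  have h1 : ∑ i, re i * π i = ∑ i, re i * (π i - m i) + ∑ i, re i * m i := by
    rw [← Finset.sum_add_distrib]
    exact Finset.sum_congr rfl fun i _ => by ring
  have h2 : ∑ i, re i * (π i - m i) ≤ ∑ i, m i / 32 := by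
    refine Finset.sum_le_sum fun i _ => ?_
    calc re i * (π i - m i) ≤ |re i * (π i - m i)| := le_abs_self _
      _ = |re i| * |π i - m i| := abs_mul _ _
      _ ≤ 1 * (m i / 32) := mul_le_mul (hre i) (hm i) (abs_nonneg _) (by norm_num)
      _ = m i / 32 := one_mul _
  have h3 : ∑ i, m i / 32 = (∑ i, m i) / 32 := by rw [Finset.sum_div]
  rw [h1]
  have h4 : (∑ i, m i) / 32 ≤ B / 32 := by linarith
  linarith

/-- **`PerCharacterDeficit` follows from the vendored Thorner–Zaman fact** (so STUB 1 is no stronger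
than what the tree already cites). For `χ ≠ 1`: `∑_C Re χ(C) π_C = ∑_C Re χ(C)(π_C − m_C) + ∑_C Re χ(C) m_C`
with `m_C` the Thorner–Zaman main term; the first sum is `≤ ∑_C |π_C − m_C| ≤ ∑ m_C/32 ≤ Li/32`; the
second is `(Li/h)·∑ Re χ = 0` without exceptional zero, and `−(Li(x^{β₁})/h)·∑_C Re (χχ₁)(C) ≤ 0` with
one (`∑_C (χχ₁)(C) ∈ {0, h}`): the exceptional zero is DROPPED BY SIGN, whatever `χ₁` is. Degree `≥ 2`
primes cost `≤ n(√x + 1)`, absorbed since `x ≥ Q^{4n+8} ≥ (100(n+1))⁴`. -/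
theorem perCharacterDeficit_of_TZ (hTZ : ThornerZaman2019_classPNT_hilbertClassField) :
    PerCharacterDeficit := by
  classical
  obtain ⟨c₁, c₂, c₃, hc₁, hc₂, hc₃, H⟩ := hTZ
  intro n hn
  set L : ℝ := max 1 (Real.log (64 * c₃)) with hLdef
  refine ⟨max (max c₁ (4 * n + 8)) (max (L / c₂) (L ^ 2 / (c₂ * Real.log 2))), ?_⟩
  intro K _ _ hKn χ hχ x hx
  have hK : 1 < Module.finrank ℚ K := by rw [hKn]; exact hn
  set C₂ : ℝ := max (max c₁ (4 * n + 8)) (max (L / c₂) (L ^ 2 / (c₂ * Real.log 2))) with hC₂def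
  set Q : ℝ := ThornerZaman.condQn K with hQdef
  set h : ℕ := NumberField.classNumber K with hhdef
  have hQ12 : 12 ≤ Q := ThornerZaman.twelve_le_condQn (K := K) hK
  have hQ1 : 1 ≤ Q := by linarith
  have hQpos : 0 < Q := by linarith
  have hC₂c₁ : c₁ ≤ C₂ := le_trans (le_max_left _ _) (le_max_left _ _)
  have hC₂n : (4 * n + 8 : ℝ) ≤ C₂ := le_trans (le_max_right _ _) (le_max_left _ _)
  have hxc₁ : Q ^ c₁ ≤ x := le_trans (Real.rpow_le_rpow_of_exponent_le hQ1 hC₂c₁) hx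
  -- x ≥ Q^{4n+8} ≥ 12^{4n+8} ≥ (100(n+1))^4
  have hxbig : (100 * ((n:ℝ) + 1)) ^ 4 ≤ x := by
    have h1 : Q ^ ((4 * n + 8 : ℕ) : ℝ) ≤ x := by
      refine le_trans (Real.rpow_le_rpow_of_exponent_le hQ1 ?_) hx
      push_cast; exact hC₂n
    rw [Real.rpow_natCast] at h1
    have h2 : (12 : ℝ) ^ (4 * n + 8) ≤ Q ^ (4 * n + 8) := pow_le_pow_left₀ (by norm_num) hQ12 _
    have h3 : ((100 * (n + 1)) ^ 4 : ℕ) ≤ 12 ^ (4 * n + 8) := pow_bound12 n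
    have h4 : (((100 * (n + 1)) ^ 4 : ℕ) : ℝ) ≤ ((12 ^ (4 * n + 8) : ℕ) : ℝ) := by exact_mod_cast h3
    push_cast at h4
    linarith
  have hsize := size_ineq n hxbig
  have hn0 : (0 : ℝ) ≤ n := Nat.cast_nonneg n
  have hx12 : 12 ≤ x := by
    have h1 : (100 : ℝ) ≤ 100 * ((n : ℝ) + 1) := by nlinarith
    have h2 : (100 : ℝ) ^ 4 ≤ (100 * ((n : ℝ) + 1)) ^ 4 := pow_le_pow_left₀ (by norm_num) h1 4
    linarith [show (12 : ℝ) ≤ 100 ^ 4 by norm_num]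
  have hxpos : 0 < x := by linarith
  have hx0 : 0 ≤ x := hxpos.le
  have hx1 : 1 < x := by linarith
  have hx2 : 2 ≤ x := by linarith
  have hlogxpos : 0 < Real.log x := Real.log_pos hx1
  have hE : c₃ * ThornerZaman.errorTermN c₂ Q (Module.finrank ℚ K) x ≤ 1 / 32 :=
    errorTermN_le_of_ge hc₂ hc₃
      (le_trans (le_max_left _ _) (le_max_right _ _))
      (le_trans (le_max_right _ _) (le_max_right _ _)) K hK hx
  have hEpos : 0 < c₃ * ThornerZaman.errorTermN c₂ Q (Module.finrank ℚ K) x :=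
    mul_pos hc₃ (ThornerZaman.errorTermN_pos _ _ _ _)
  -- Li ≥ x/log x − 2
  have hLi : x / Real.log x - 2 ≤ offsetLogIntegral x := by
    have h1 := sub_mul_inv_log_pow_le_offsetLogIntegralPow 1 hx2
    rw [offsetLogIntegralPow_one, pow_one, ← div_eq_mul_inv] at h1
    have h2 : x / Real.log x - 2 ≤ (x - 2) / Real.log x := by
      rw [sub_div]
      have hlogx1 : 1 ≤ Real.log x := by
        rw [Real.le_log_iff_exp_le hxpos]
        have := Real.exp_one_lt_d9
        linarith
      have : 2 / Real.log x ≤ 2 := by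
        rw [div_le_iff₀ hlogxpos]; nlinarith
      linarith
    linarith
  have hX0 : 0 ≤ x / Real.log x := by positivity
  -- two-sided per-class accuracy with relative error ≤ 1/32
  have key : ∀ (π m : ℝ), |π - m| ≤ c₃ * ThornerZaman.errorTermN c₂ Q (Module.finrank ℚ K) x * m →
      |π - m| ≤ m / 32 ∧ 0 ≤ m := by
    intro π m hπ
    have hm : 0 ≤ m := by
      by_contra hneg
      rw [not_le] at hneg
      have : c₃ * ThornerZaman.errorTermN c₂ Q (Module.finrank ℚ K) x * m < 0 :=
        mul_neg_of_pos_of_neg hEpos hneg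
      linarith [abs_nonneg (π - m)]
    refine ⟨le_trans hπ ?_, hm⟩
    have := mul_le_mul_of_nonneg_right hE hm
    linarith
  have hcardC : ((Finset.univ : Finset (ClassGroup (𝓞 K))).card : ℝ) = h := by
    rw [Finset.card_univ, hhdef, NumberField.classNumber]
  have hhpos : (0 : ℝ) < h := by exact_mod_cast NumberField.classNumber_pos (K := K)
  have hre1 : ∀ C : ClassGroup (𝓞 K), |((χ C : ℂ)).re| ≤ 1 := fun C => char_abs_re_le_one χ C
  -- (1) degree-one counts vs all primes, class by class
  have hS := sum_re_mul_le_add (fun C : ClassGroup (𝓞 K) => ((χ C : ℂ)).re)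
    (fun C => (degOneClassCount K C x : ℝ)) (fun C => (primeIdealClassCount K C x : ℝ)) hre1
    (fun C => by exact_mod_cast degOneClassCount_le K C x)
  beta_reduce at hS
  have hdeg := primeIdealCount_le_sum_degOneClassCount_add K hx0
  rw [hKn] at hdeg
  have htot : (primeIdealCount K x : ℝ) = ∑ C : ClassGroup (𝓞 K), (primeIdealClassCount K C x : ℝ) := by
    exact_mod_cast primeIdealCount_eq_sum_classCount K x
  -- (2) the main estimate: ∑_C Re χ(C) π_C ≤ Li/32
  have hT : ∑ C : ClassGroup (𝓞 K), ((χ C : ℂ)).re * (primeIdealClassCount K C x : ℝ) ≤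
      offsetLogIntegral x / 32 := by
    rcases H K hK with ⟨-, hA⟩ | ⟨χ₁, β₁, hreal, hβlo, hβhi, -, hB⟩
    · -- no exceptional zero: main term Li/h, ∑ Re χ = 0
      have hb : ∀ C : ClassGroup (𝓞 K),
          |(primeIdealClassCount K C x : ℝ) - offsetLogIntegral x / h| ≤ (offsetLogIntegral x / h) / 32 :=
        fun C => (key _ _ (hA C x hxc₁)).1
      refine sum_re_mul_le_of_main (fun C : ClassGroup (𝓞 K) => ((χ C : ℂ)).re)
        (fun C => (primeIdealClassCount K C x : ℝ)) (fun _ => offsetLogIntegral x / h)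
        (offsetLogIntegral x) hre1 hb ?_ ?_
      · rw [Finset.sum_const, nsmul_eq_mul, hcardC]
        field_simp
        exact le_refl _
      · rw [← Finset.sum_mul, sum_re_char_eq_zero χ hχ, zero_mul]
    · -- exceptional (χ₁, β₁): main term m_C = (Li − Re χ₁(C) Li(x^β₁))/h
      have hβhalf : (1:ℝ) / 2 ≤ β₁ := by
        have hlogQ : Real.log 12 ≤ Real.log Q := Real.log_le_log (by norm_num) hQ12
        have hlog12 : (1 : ℝ) < Real.log 12 := by
          have := Real.exp_one_lt_d9
          rw [Real.lt_log_iff_exp_lt (by norm_num)]; linarith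
        have hlogQpos : 0 < Real.log Q := by linarith
        have : 1 / (8 * Real.log Q) ≤ 1 / 8 := by
          rw [div_le_div_iff₀ (by positivity) (by norm_num)]; nlinarith
        linarith
      have hxβ : 2 ≤ x ^ β₁ := by
        have hx1' : (1:ℝ) ≤ x := hx1.le
        calc (2 : ℝ) ≤ 12 ^ ((1:ℝ) / 2) := by
              rw [show (12:ℝ) = 2 ^ (2:ℝ) * 3 by norm_num, Real.mul_rpow (by positivity) (by norm_num),
                ← Real.rpow_mul (by norm_num)]
              norm_num
              have : (1:ℝ) ≤ (3:ℝ) ^ ((1:ℝ)/2) := Real.one_le_rpow (by norm_num) (by norm_num)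
              linarith
          _ ≤ x ^ ((1:ℝ) / 2) := Real.rpow_le_rpow (by norm_num) hx12 (by norm_num)
          _ ≤ x ^ β₁ := Real.rpow_le_rpow_of_exponent_le hx1' hβhalf
      have hLβ : 0 ≤ offsetLogIntegral (x ^ β₁) := by
        have := sub_mul_inv_log_pow_le_offsetLogIntegralPow 1 hxβ
        rw [offsetLogIntegralPow_one] at this
        have h0 : 0 ≤ (x ^ β₁ - 2) * (Real.log (x ^ β₁))⁻¹ ^ 1 := by
          apply mul_nonneg (by linarith)
          apply pow_nonneg; apply inv_nonneg.2; apply Real.log_nonneg; linarith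
        linarith
      have hb : ∀ C : ClassGroup (𝓞 K),
          |(primeIdealClassCount K C x : ℝ) -
              (offsetLogIntegral x - ((χ₁ C : ℂ)).re * offsetLogIntegral (x ^ β₁)) / h| ≤
            ((offsetLogIntegral x - ((χ₁ C : ℂ)).re * offsetLogIntegral (x ^ β₁)) / h) / 32 :=
        fun C => (key _ _ (hB C x hxc₁)).1
      refine sum_re_mul_le_of_main (fun C : ClassGroup (𝓞 K) => ((χ C : ℂ)).re)
        (fun C => (primeIdealClassCount K C x : ℝ))
        (fun C => (offsetLogIntegral x - ((χ₁ C : ℂ)).re * offsetLogIntegral (x ^ β₁)) / h)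
        (offsetLogIntegral x) hre1 hb ?_ ?_
      · -- ∑ m_C = Li − (∑ Re χ₁/h)·Li(x^β₁) ≤ Li
        have e : ∑ C : ClassGroup (𝓞 K),
            (offsetLogIntegral x - ((χ₁ C : ℂ)).re * offsetLogIntegral (x ^ β₁)) / (h : ℝ)
            = ((h : ℝ) * offsetLogIntegral x
                - (∑ C : ClassGroup (𝓞 K), ((χ₁ C : ℂ)).re) * offsetLogIntegral (x ^ β₁)) / h := by
          rw [← Finset.sum_div, Finset.sum_sub_distrib, Finset.sum_const, nsmul_eq_mul, Finset.sum_mul,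
            hcardC]
        rw [e, div_le_iff₀ hhpos]
        have h1 := sum_re_char_nonneg χ₁
        nlinarith [mul_nonneg h1 hLβ]
      · -- ∑ Re χ · m = (Li/h) ∑ Re χ − (Li(x^β₁)/h) ∑ Re (χχ₁) ≤ 0
        have e : ∀ C : ClassGroup (𝓞 K), ((χ C : ℂ)).re *
            ((offsetLogIntegral x - ((χ₁ C : ℂ)).re * offsetLogIntegral (x ^ β₁)) / h)
            = ((χ C : ℂ)).re * (offsetLogIntegral x / h)
              - (((χ * χ₁) C : ℂˣ) : ℂ).re * (offsetLogIntegral (x ^ β₁) / h) := by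
          intro C
          rw [← re_mul_re_of_real χ χ₁ hreal C]
          ring
        rw [Finset.sum_congr rfl (fun C _ => e C), Finset.sum_sub_distrib, ← Finset.sum_mul,
          ← Finset.sum_mul, sum_re_char_eq_zero χ hχ, zero_mul, zero_sub]
        have h1 := sum_re_char_nonneg (χ * χ₁)
        have h2 : 0 ≤ offsetLogIntegral (x ^ β₁) / h := div_nonneg hLβ hhpos.le
        nlinarith [mul_nonneg h1 h2]
  -- (3) assembly: 8·S ≤ 8·(Li/32 + n√x + n) ≤ Li
  have hsqrt0 : 0 ≤ Real.sqrt x := Real.sqrt_nonneg _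
  have hns0 : 0 ≤ (n : ℝ) * Real.sqrt x := mul_nonneg hn0 hsqrt0
  have e1 : (n : ℝ) * (Real.sqrt x + 1) = n * Real.sqrt x + n := by ring
  rw [e1] at hdeg
  linarith [hS, hT, hdeg, htot, hLi, hsize, hsqrt0, hn0, hns0, hX0]


/-! ### The crux from the two in-tree named facts, through this skeleton

Stated over named `Prop`s so that `DegreeOnePrimesEscape_of` stays the ONLY theorem of this file
concluding the crux by name (the skeleton audit takes the first such theorem as the skeleton). -/

/-- The crux under Thorner–Zaman + Stark (explicit), as a named `Prop`. -/
def CruxFromTZStark : Prop :=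
  ThornerZaman2019_classPNT_hilbertClassField → Stark1974_dedekindZeta_ne_zero_of_noQuadraticSubfield →
    Summit.QuantumAdvantage.QuantumAdvantage.Theses.LinnikCubicClassGroups.DegreeOnePrimesEscape

/-- The crux under Thorner–Zaman + the INEXPLICIT Stark stub, as a named `Prop`. -/
def CruxFromTZStarkInexplicit : Prop :=
  ThornerZaman2019_classPNT_hilbertClassField → StarkNoQuadSubfieldInexplicit →
    Summit.QuantumAdvantage.QuantumAdvantage.Theses.LinnikCubicClassGroups.DegreeOnePrimesEscape

/-- **THE CRUX from Thorner–Zaman 2019 Thm 1.4 (Hilbert class field) and Stark 1974, through this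
skeleton** (second kernel-checked conditional proof of `DegreeOnePrimesEscape`, independent of
`OneSidedShadows.degreeOnePrimesEscape_of_TZ_Stark`; no upper prime-ideal bound is ever formed). -/
theorem cruxFromTZStark_holds : CruxFromTZStark := fun hTZ hSt =>
  cruxFromV3_holds (perCharacterDeficit_of_TZ hTZ) (lowerPITUnlessNearbyZero_of_TZ hTZ)
    (starkNoQuadSubfield_of_named hSt)

/-- … and with the inexplicit Stark statement (the docking port for `heilbronn-count-discharge`). -/
theorem cruxFromTZStarkInexplicit_holds : CruxFromTZStarkInexplicit := fun hTZ hSt =>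
  cruxFromV3_holds (perCharacterDeficit_of_TZ hTZ) (lowerPITUnlessNearbyZero_of_TZ hTZ) hSt


/-! ## Appendix · Co-registered stubs of the FIRST lead's line `dedekind-s3-collision`

The crux item `stmt-QuantumAdvantage-11543` holds ONE stub registry, but the harness seated two line leads
(prover-line-…-11543-0 on `dedekind-s3-collision`, this seat on `subgroup-orthogonality-escape`);
`ledger skeleton check` by either lead deactivates the other's stubs ("not in skeleton …"). To keep both
lines' stubs registered — so that every `propose --supports stmt-QuantumAdvantage-11543` of EITHER lead
matches a registered stub by name and signature — the six stubs of `Lines/dedekind-s3-collision.lean`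
(v as of commit 1885d4ec9908, signatures VERBATIM from the item's stub list) are restated here, sorried,
in the sub-namespace `FirstLead`. They are NOT used by this line's composition (audit: orphans); their
composition is the first lead's `DegreeOnePrimesEscape_of` in their skeleton. If the first lead reshapes,
this appendix must be refreshed from `ledger workitem get … --json` (payload.stubs). -/

namespace FirstLead

/-- Co-registered (first lead, `dedekind-s3-collision` STUB 1): the `S₃` Dedekind-zeta relation. -/
theorem stub_dedekindRelation :
    ∀ (N : Type) [Field N] [NumberField N] [IsGalois ℚ N], Module.finrank ℚ N = 6 →
      (∃ g h : N ≃ₐ[ℚ] N, g * h ≠ h * g) →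
      ∀ (K k : IntermediateField ℚ N), Module.finrank ℚ K = 3 → Module.finrank ℚ k = 2 →
      ∀ s : ℂ, 1 < s.re →
        NumberField.dedekindZeta N s * riemannZeta s ^ 2 =
          NumberField.dedekindZeta k s * NumberField.dedekindZeta K s ^ 2 := by
  sorry

/-- Co-registered (first lead STUB 2): cubic closure bound. -/
theorem stub_cubicClosure :
    ∃ A : ℕ, ∀ (K : Type) [Field K] [NumberField K], Module.finrank ℚ K = 3 → ¬ IsGalois ℚ K →
      ∃ (N : Type) (_ : Field N) (_ : NumberField N), IsGalois ℚ N ∧ Module.finrank ℚ N = 6 ∧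
        (∃ g h : N ≃ₐ[ℚ] N, g * h ≠ h * g) ∧
        (∃ K' : IntermediateField ℚ N, Nonempty (K ≃ₐ[ℚ] K')) ∧
        (∃ k : IntermediateField ℚ N, Module.finrank ℚ k = 2) ∧
        (NumberField.discr N).natAbs ≤ (NumberField.discr K).natAbs ^ A := by
  sorry

/-- Co-registered (first lead STUB 3): the collision transfer. -/
theorem stub_collisionTransfer :
    (∀ (N : Type) [Field N] [NumberField N] [IsGalois ℚ N], Module.finrank ℚ N = 6 →
      (∃ g h : N ≃ₐ[ℚ] N, g * h ≠ h * g) →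
      ∀ (K k : IntermediateField ℚ N), Module.finrank ℚ K = 3 → Module.finrank ℚ k = 2 →
      ∀ s : ℂ, 1 < s.re →
        NumberField.dedekindZeta N s * riemannZeta s ^ 2 =
          NumberField.dedekindZeta k s * NumberField.dedekindZeta K s ^ 2) →
    (∃ A : ℕ, ∀ (K : Type) [Field K] [NumberField K], Module.finrank ℚ K = 3 → ¬ IsGalois ℚ K →
      ∃ (N : Type) (_ : Field N) (_ : NumberField N), IsGalois ℚ N ∧ Module.finrank ℚ N = 6 ∧
        (∃ g h : N ≃ₐ[ℚ] N, g * h ≠ h * g) ∧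
        (∃ K' : IntermediateField ℚ N, Nonempty (K ≃ₐ[ℚ] K')) ∧
        (∃ k : IntermediateField ℚ N, Module.finrank ℚ k = 2) ∧
        (NumberField.discr N).natAbs ≤ (NumberField.discr K).natAbs ^ A) →
    ∃ c : ℝ, 0 < c ∧ ∀ (K : Type) [Field K] [NumberField K], Module.finrank ℚ K = 3 → ¬ IsGalois ℚ K →
      ∀ σ : ℝ, 1 - c / Real.log ((NumberField.discr K).natAbs : ℝ) ≤ σ → σ < 1 →
        dedekindZetaCont K σ ≠ 0 := by
  sorry

/-- Co-registered (first lead STUB 4): Galois cubic zero-free interval. -/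
theorem stub_galoisCubicZeroFree :
    ∃ c : ℝ, 0 < c ∧ ∀ (K : Type) [Field K] [NumberField K], Module.finrank ℚ K = 3 → IsGalois ℚ K →
      ∀ σ : ℝ, 1 - c / Real.log ((NumberField.discr K).natAbs : ℝ) ≤ σ → σ < 1 →
        dedekindZetaCont K σ ≠ 0 := by
  sorry

/-- Co-registered (first lead STUB 5): Stark residue in degrees `≠ 3`. -/
theorem stub_starkResidue :
    ∀ n : ℕ, n ≠ 3 →
      ∃ c : ℝ, 0 < c ∧ ∀ (K : Type) [Field K] [NumberField K], Module.finrank ℚ K = n →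
        (∀ F : IntermediateField ℚ K, Module.finrank ℚ F ≠ 2) →
        ∀ σ : ℝ, 1 - c / Real.log ((NumberField.discr K).natAbs : ℝ) ≤ σ → σ < 1 →
          dedekindZetaCont K σ ≠ 0 := by
  sorry

/-- Co-registered (first lead STUB 6): the Thorner–Zaman fact itself. -/
theorem stub_thornerZaman : ThornerZaman2019_classPNT_hilbertClassField := by
  sorry

/-- Docking: the first lead's stubs 4 + 5 + the `n = 3` non-Galois case (their stub 3 applied to 1, 2)
give this line's `StarkNoQuadSubfieldInexplicit` in degrees `≠ 3` directly; recorded as the degree-`≠ 3`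
half (the `n = 3` half needs their stubs 1–3 and `IsGalois` case split, done in their skeleton). -/
theorem starkNoQuadSubfield_ne_three_of_firstLead (n : ℕ) (hn : n ≠ 3) :
    ∃ c : ℝ, 0 < c ∧ ∀ (K : Type) [Field K] [NumberField K], Module.finrank ℚ K = n →
      (∀ F : IntermediateField ℚ K, Module.finrank ℚ F ≠ 2) →
      ∀ σ : ℝ, 1 - c / Real.log ((NumberField.discr K).natAbs : ℝ) ≤ σ → σ < 1 →
        dedekindZetaCont K σ ≠ 0 :=
  stub_starkResidue n hn

end FirstLead

end Summit.QuantumAdvantage.QuantumAdvantage.Cruxes.DegreeOnePrimesEscape.SubgroupOrthogonalityEscape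

end
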